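import Summits.CriticalPhenomena.SAWScalingLimit.Cruxes.MassRatio.Disproof
import Literature.Probability.RandomPlanarGeometry.HexSAWLemma2

/-!
# Disproof companion (cycle 3, §K): EXHAUSTION IS LOAD-BEARING for the crux `MassRatio` and for stub 2

Companion workfile of `Cruxes/MassRatio/Disproof.lean` (refuter, `cdisprove`, crux `MassRatio` =
stmt-CriticalPhenomena-8550); it imports the main module (toolkit + Part II) and lives in the same
namespace. `sorry`-free, axioms `propext, Classical.choice, Quot.sound`.

Headlines: `massRatio_false_without_exhaustion : ¬ MassRatioWithoutExhaustion`;
`localL1BoundZ_false_without_exhaustion : s ≤ 1 → ¬ LocalL1BoundZWithoutExhaustion s` (the registered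
stub `stub_localL1BoundZ` with exhaustion deleted, any `s ≤ 1`) and its `∀ s > 0` corollary;
`localL1Bound_false_without_exhaustion` (round-1 normalisation). Witness family `Λ₃` = bare corridor
(staircase into `Kbox`, run along row `m+iK+2`) feeding the blob (lattice parallelogram
`X₁ ≤ x₀ ≤ X₂`, rows `m…m+iK+1`, containing the quarter-ball about `b`: the ROWS CLAUSE HOLDS at
`ρ = 1/4`), in `D₀`, with `a_δ = aE`, `b_δ = bE`; frame `frame_Λ₃` (simply connected — `linked_compl_Λ₃`;
boundary; `Nonempty` via the general `nonempty_saw_of_preconnected`; connected; inside; rows).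
Mechanism: `corridor_prefix` (forced prefix) ⇒ `norm_F_le_corridor_blob` (`|F_σ(z)| ≤ x^{L+1} Z_Blob(entry→z)`);
`norm_Z_blob_le_one` (chart `Φ₃ = shift ∘ flip ∘ hvIso` onto the DCS strip `S_{T,L}`, `b_δ ↦ β`-dart,
`Z_Blob ≤ B_{T,L}(x_c) ≤ 1` by `stripB_le_one_of_lemma2 DuminilCopinSmirnov2012_lemma2_holds`);
`corridor_edge_unique` / `norm_F_corridor_edge` (`|F_σ(e₀)| = x^{2iK+1}` exactly, every spin);
`endgame'`; `Λ₃_violates` (any spins `σ, τ`, any `C`, any `s ≤ 1`).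
-/

namespace Summit.CriticalPhenomena.SAWScalingLimit.Cruxes.MassRatio.Disproof

open Literature.Probability.LatticeModels Literature.Probability.RandomPlanarGeometry.SAW
open Literature.Probability.RandomPlanarGeometry
open Summit.CriticalPhenomena.SAWScalingLimit.Theses.SAWDefectDecoherence

/-! ### K.1 Parameters of the family `Λ₃` -/

/-- left `x₀`-cut of the blob -/
noncomputable def X₁ (δ : ℝ) : ℤ := ⌊(3 / 2 * (1 / δ) - 6 - (mRow δ : ℝ) - (iK δ : ℝ)) / 2⌋
/-- right `x₀`-cut of the blob -/
noncomputable def X₂ (δ : ℝ) : ℤ := ⌈(5 / 2 * (1 / δ) - (mRow δ : ℝ)) / 2⌉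
/-- the corridor's top row -/
noncomputable def rT (δ : ℝ) : ℤ := mRow δ + iK δ + 2
/-- position of the last corridor vertex (and of the blob's entry vertex below it) -/
noncomputable def pE (δ : ℝ) : ℤ := 2 * X₁ δ + mRow δ + iK δ + 2
/-- index of the last staircase vertex of the corridor -/
noncomputable def I₀ (δ : ℝ) : ℕ := 2 * iK δ + 4
/-- number of run steps after the staircase -/
noncomputable def J (δ : ℝ) : ℕ := (pE δ - pA δ + iK δ + 2).toNat
/-- index of the last corridor vertex -/
noncomputable def L₃ (δ : ℝ) : ℕ := I₀ δ + J δ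

section Params3

variable {δ : ℝ}

theorem X₁_le (δ : ℝ) : 2 * (X₁ δ : ℝ) ≤ 3 / 2 * (1 / δ) - 6 - mRow δ - iK δ := by
  have := Int.floor_le ((3 / 2 * (1 / δ) - 6 - (mRow δ : ℝ) - (iK δ : ℝ)) / 2)
  unfold X₁; linarith

theorem lt_X₁ (δ : ℝ) : 3 / 2 * (1 / δ) - 8 - mRow δ - iK δ < 2 * (X₁ δ : ℝ) := by
  have := Int.lt_floor_add_one ((3 / 2 * (1 / δ) - 6 - (mRow δ : ℝ) - (iK δ : ℝ)) / 2)
  unfold X₁; linarith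

theorem le_X₂ (δ : ℝ) : 5 / 2 * (1 / δ) - mRow δ ≤ 2 * (X₂ δ : ℝ) := by
  have := Int.le_ceil ((5 / 2 * (1 / δ) - (mRow δ : ℝ)) / 2)
  unfold X₂; linarith

theorem X₂_lt (δ : ℝ) : 2 * (X₂ δ : ℝ) < 5 / 2 * (1 / δ) - mRow δ + 2 := by
  have := Int.ceil_lt_add_one ((5 / 2 * (1 / δ) - (mRow δ : ℝ)) / 2)
  unfold X₂; linarith

/-- The integer inequalities between the parameters of `Λ₃`, for `0 < δ ≤ 1/100`. -/
theorem params₃ (hδ : 0 < δ) (hδ1 : δ ≤ 1 / 100) :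
    X₁ δ ≤ X₂ δ ∧ pA δ + 10 ≤ 2 * X₁ δ + mRow δ ∧
      2 * X₂ δ + mRow δ + (iK δ : ℤ) + 4 ≤ PPos δ ∧
      2 * X₁ δ ≤ pB δ - mRow δ ∧ pB δ - mRow δ ≤ 2 * X₂ δ ∧
      2 * ((iK δ : ℤ)) ≤ pE δ - pA δ + iK δ + 2 ∧ 0 ≤ pE δ - pA δ + iK δ + 2 := by
  obtain ⟨hiM, hM0, hm10, hPa, hpa, hpb, hbP, hP100, -⟩ := params hδ hδ1
  have ht := t_ge hδ hδ1
  have hs := s_eq hδ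
  set t := 1 / (δ * hgt) with ht_def
  set s := 1 / δ with hs_def
  have hg1 := hgt_gt
  have hg2 := hgt_lt
  have h1 := mRow_le δ
  have h2 := lt_mRow δ
  have h5 := le_PPos δ
  have h7 := pA_le δ
  have h8 := lt_pA δ
  have h9 := pB_le δ
  have h10 := lt_pB δ
  have h11 := iK_le' hδ
  have h12 := lt_iK' δ
  have a1 := X₁_le δ
  have a2 := lt_X₁ δ
  have a3 := le_X₂ δ
  have a4 := X₂_lt δ
  simp only [← ht_def, ← hs_def] at h1 h2 h5 h7 h8 h9 h10 h11 h12 a1 a2 a3 a4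
  have hik0 : (0:ℝ) ≤ (iK δ : ℝ) := by positivity
  have hs85 : (85:ℝ) ≤ s := by nlinarith
  refine ⟨?_, ?_, ?_, ?_, ?_, ?_, ?_⟩
  · have : (X₁ δ : ℝ) ≤ X₂ δ := by nlinarith
    exact_mod_cast this
  · have : (pA δ : ℝ) + 10 ≤ 2 * X₁ δ + mRow δ := by nlinarith
    exact_mod_cast this
  · have : 2 * (X₂ δ : ℝ) + mRow δ + iK δ + 4 ≤ PPos δ := by nlinarith
    exact_mod_cast this
  · have : 2 * (X₁ δ : ℝ) ≤ pB δ - mRow δ := by nlinarith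
    exact_mod_cast this
  · have : (pB δ : ℝ) - mRow δ ≤ 2 * X₂ δ := by nlinarith
    exact_mod_cast this
  · have : 2 * (iK δ : ℝ) ≤ (2 * X₁ δ + mRow δ + iK δ + 2 : ℝ) - pA δ + iK δ + 2 := by nlinarith
    unfold pE; exact_mod_cast this
  · have : (0 : ℝ) ≤ (2 * X₁ δ + mRow δ + iK δ + 2 : ℝ) - pA δ + iK δ + 2 := by nlinarith
    unfold pE; exact_mod_cast this

theorem J_eq (hδ : 0 < δ) (hδ1 : δ ≤ 1 / 100) : (J δ : ℤ) = pE δ - pA δ + iK δ + 2 := by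
  obtain ⟨-, -, -, -, -, -, h⟩ := params₃ hδ hδ1
  unfold J; omega

end Params3

/-! ### K.2 The corridor `c₃`, the blob, the family `Λ₃` -/

/-- the `x₀` coordinate of a vertex -/
def xz (v : HexVertex) : ℤ := v.1 0

theorem xz_bv (r p : ℤ) : xz (bv r p) = (p - r - (p - r) % 2) / 2 := by simp [xz, bv]

theorem two_xz (v : HexVertex) : 2 * xz v = pos v - row v - (pos v - row v) % 2 := by
  obtain ⟨y, i⟩ := v
  have hi : (i : ℕ) = 0 ∨ (i : ℕ) = 1 := by have := i.isLt; omega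
  unfold xz pos row
  simp only
  rcases hi with h | h <;> rw [h] <;> omega

/-- **The corridor**: the staircase `S_0, …, S_{2 iK + 4}` from the root up-left to the row
`rT = m + iK + 2`, then the run to the right along that row up to position `pE`. -/
noncomputable def c₃ (δ : ℝ) (i : ℕ) : HexVertex :=
  bv (mRow δ + ((min i (I₀ δ) / 2 : ℕ) : ℤ))
    (pA δ - (((min i (I₀ δ) + 1) / 2 : ℕ) : ℤ) + ((i - min i (I₀ δ) : ℕ) : ℤ))

/-- the blob's entry vertex `X`, right below the last corridor vertex -/
noncomputable def Xv (δ : ℝ) : HexVertex := bv (mRow δ + iK δ + 1) (pE δ)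

/-- **The blob**: the lattice parallelogram `X₁ ≤ x₀ ≤ X₂`, rows `m … m + iK + 1`. -/
noncomputable def Blob (δ : ℝ) : Finset HexVertex :=
  ((Finset.Icc (X₁ δ) (X₂ δ)) ×ˢ (Finset.Icc (mRow δ) (mRow δ + iK δ + 1)) ×ˢ
      (Finset.univ : Finset (Fin 2))).image fun t => ((![t.1, t.2.1] : Site 2), t.2.2)

/-- the corridor as a finite set -/
noncomputable def Corr (δ : ℝ) : Finset HexVertex := (Finset.range (L₃ δ + 1)).image (c₃ δ)

/-- **The corridor-fed blob family** (violates exhaustion, satisfies everything else). -/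
noncomputable def Λ₃ (δ : ℝ) : Finset HexVertex := Corr δ ∪ Blob δ

section Family3

variable {δ : ℝ}

theorem row_c₃ (δ : ℝ) (i : ℕ) : row (c₃ δ i) = mRow δ + ((min i (I₀ δ) / 2 : ℕ) : ℤ) := by
  simp [c₃]

theorem pos_c₃ (δ : ℝ) (i : ℕ) :
    pos (c₃ δ i) = pA δ - (((min i (I₀ δ) + 1) / 2 : ℕ) : ℤ) + ((i - min i (I₀ δ) : ℕ) : ℤ) := by
  simp [c₃, pos_bv]

theorem c₃_eq_stair {i : ℕ} (hi : i ≤ I₀ δ) : c₃ δ i = stair δ i := by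
  unfold c₃ stair
  rw [min_eq_left hi, Nat.sub_self]
  simp

theorem c₃_zero (δ : ℝ) : c₃ δ 0 = bv (mRow δ) (pA δ) := by
  rw [c₃_eq_stair (Nat.zero_le _), stair_zero]

theorem c₃_L₃ (δ : ℝ) : c₃ δ (L₃ δ) = bv (rT δ) (pA δ - iK δ - 2 + J δ) := by
  unfold c₃ L₃ rT I₀
  congr 1
  · rw [min_eq_right (by omega)]; push_cast; omega
  · rw [min_eq_right (by omega)]
    have e : ((2 * iK δ + 4 + 1) / 2 : ℕ) = iK δ + 2 := by omega
    rw [e]; push_cast; omega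

theorem mem_Blob {v : HexVertex} :
    v ∈ Blob δ ↔ X₁ δ ≤ xz v ∧ xz v ≤ X₂ δ ∧ mRow δ ≤ row v ∧ row v ≤ mRow δ + iK δ + 1 := by
  simp only [Blob, Finset.mem_image, Finset.mem_product, Finset.mem_Icc, Finset.mem_univ,
    and_true, Prod.exists]
  constructor
  · rintro ⟨x, r, i, ⟨⟨h1, h2⟩, h3, h4⟩, rfl⟩
    simp only [xz, row, Matrix.cons_val_zero, Matrix.cons_val_one]
    exact ⟨h1, h2, h3, h4⟩
  · rintro ⟨h1, h2, h3, h4⟩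
    refine ⟨xz v, row v, v.2, ⟨⟨h1, h2⟩, h3, h4⟩, ?_⟩
    obtain ⟨y, i⟩ := v
    simp only [xz, row]
    congr
    ext j; fin_cases j <;> rfl

theorem bv_mem_Blob {r p : ℤ} :
    bv r p ∈ Blob δ ↔ X₁ δ ≤ (p - r - (p - r) % 2) / 2 ∧ (p - r - (p - r) % 2) / 2 ≤ X₂ δ ∧
      mRow δ ≤ r ∧ r ≤ mRow δ + iK δ + 1 := by
  rw [mem_Blob, xz_bv, row_bv]

theorem mem_Corr {v : HexVertex} : v ∈ Corr δ ↔ ∃ i, i ≤ L₃ δ ∧ c₃ δ i = v := by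
  simp only [Corr, Finset.mem_image, Finset.mem_range]
  constructor
  · rintro ⟨i, hi, h⟩; exact ⟨i, by omega, h⟩
  · rintro ⟨i, hi, h⟩; exact ⟨i, by omega, h⟩

theorem mem_Λ₃ {v : HexVertex} : v ∈ Λ₃ δ ↔ (∃ i, i ≤ L₃ δ ∧ c₃ δ i = v) ∨ v ∈ Blob δ := by
  rw [Λ₃, Finset.mem_union, mem_Corr]

theorem c₃_mem (δ : ℝ) {i : ℕ} (hi : i ≤ L₃ δ) : c₃ δ i ∈ Λ₃ δ :=
  mem_Λ₃.2 (Or.inl ⟨i, hi, rfl⟩)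

/-- Coordinates of the corridor vertices, piecewise (staircase part / run part). -/
theorem c₃_coords (δ : ℝ) (i : ℕ) :
    (i ≤ I₀ δ ∧ row (c₃ δ i) = mRow δ + ((i / 2 : ℕ) : ℤ) ∧
        pos (c₃ δ i) = pA δ - (((i + 1) / 2 : ℕ) : ℤ)) ∨
      (I₀ δ ≤ i ∧ row (c₃ δ i) = mRow δ + iK δ + 2 ∧
        pos (c₃ δ i) = pA δ - iK δ - 2 + ((i - I₀ δ : ℕ) : ℤ)) := by
  rcases le_total i (I₀ δ) with hi | hi
  · left
    rw [c₃_eq_stair hi]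
    unfold stair
    exact ⟨hi, by simp, by simp [pos_bv]⟩
  · right
    refine ⟨hi, ?_, ?_⟩
    · rw [row_c₃, min_eq_right hi]; unfold I₀; push_cast; omega
    · rw [pos_c₃, min_eq_right hi]
      unfold I₀
      have e : ((2 * iK δ + 4 + 1) / 2 : ℕ) = iK δ + 2 := by omega
      rw [e]; push_cast; ring

/-- Corridor vertices are pairwise distinct. -/
theorem c₃_inj (δ : ℝ) {i j : ℕ} (h : c₃ δ i = c₃ δ j) : i = j := by
  have hr := congrArg row h
  have hp := congrArg pos h
  rcases c₃_coords δ i with ⟨hi, r1, p1⟩ | ⟨hi, r1, p1⟩ <;>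
    rcases c₃_coords δ j with ⟨hj, r2, p2⟩ | ⟨hj, r2, p2⟩ <;>
    · rw [r1, r2] at hr; rw [p1, p2] at hp; unfold I₀ at *; omega

/-- Consecutive corridor vertices are adjacent. -/
theorem adj_c₃ (δ : ℝ) (i : ℕ) : hexGraph.Adj (c₃ δ i) (c₃ δ (i + 1)) := by
  rcases Nat.lt_or_ge i (I₀ δ) with hi | hi
  · rw [c₃_eq_stair hi.le, c₃_eq_stair (by omega)]; exact adj_stair δ i
  · unfold c₃
    rw [min_eq_right hi, min_eq_right (by omega), adj_bv_iff]
    left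
    exact ⟨rfl, Or.inl (by push_cast; omega)⟩

/-- **Adjacent corridor vertices are consecutive** (the corridor is an induced path). -/
theorem adj_c₃_imp (δ : ℝ) {i j : ℕ} (h : hexGraph.Adj (c₃ δ i) (c₃ δ j)) : i = j + 1 ∨ j = i + 1 := by
  have hmod := pA_mod δ
  rw [adj_iff] at h
  rcases c₃_coords δ i with ⟨hi, r1, p1⟩ | ⟨hi, r1, p1⟩ <;>
    rcases c₃_coords δ j with ⟨hj, r2, p2⟩ | ⟨hj, r2, p2⟩ <;>
    · rw [r1, r2, p1, p2] at h; unfold I₀ at *; omega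

/-- The last corridor vertex sits right above the entry vertex `X`. -/
theorem adj_c₃_Xv (hδ : 0 < δ) (hδ1 : δ ≤ 1 / 100) : hexGraph.Adj (c₃ δ (L₃ δ)) (Xv δ) := by
  have hJ := J_eq hδ hδ1
  have hmod := pA_mod δ
  rw [c₃_L₃, Xv, adj_bv_iff]
  right; left
  unfold rT pE at *
  refine ⟨by omega, by omega, ?_⟩
  omega

theorem Xv_mem_Blob (hδ : 0 < δ) (hδ1 : δ ≤ 1 / 100) : Xv δ ∈ Blob δ := by
  obtain ⟨h12, -⟩ := params₃ hδ hδ1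
  rw [Xv, bv_mem_Blob]
  unfold pE
  omega

/-- The blob meets the corridor's neighbourhood only at `X`, below the last corridor vertex. -/
theorem blob_adj_c₃ (hδ : 0 < δ) (hδ1 : δ ≤ 1 / 100) {i : ℕ} (hi : i ≤ L₃ δ) {w : HexVertex}
    (hw : w ∈ Blob δ) (h : hexGraph.Adj (c₃ δ i) w) : i = L₃ δ ∧ w = Xv δ := by
  obtain ⟨h12, hfar, -⟩ := params₃ hδ hδ1
  have hJ := J_eq hδ hδ1
  have hmod := pA_mod δ
  rw [mem_Blob] at hw
  have hx := two_xz w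
  rw [adj_iff, row_c₃, pos_c₃] at h
  unfold L₃ at hi ⊢
  unfold pE at hJ
  have key : row w = mRow δ + iK δ + 1 ∧ pos w = pE δ ∧ i = I₀ δ + J δ := by
    unfold pE I₀ at *
    omega
  refine ⟨key.2.2, ?_⟩
  rw [← bv_row_pos w, key.1, key.2.1, Xv]

/-- Corridor and blob are disjoint. -/
theorem c₃_not_mem_Blob (hδ : 0 < δ) (hδ1 : δ ≤ 1 / 100) (i : ℕ) : c₃ δ i ∉ Blob δ := by
  obtain ⟨h12, hfar, -⟩ := params₃ hδ hδ1
  have hmod := pA_mod δ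
  intro h
  rw [mem_Blob] at h
  have hx := two_xz (c₃ δ i)
  rw [row_c₃, pos_c₃] at hx
  rw [row_c₃] at h
  unfold pE I₀ at *
  omega

/-- **Bareness of the corridor inside `Λ₃`.** -/
theorem bare₃ (hδ : 0 < δ) (hδ1 : δ ≤ 1 / 100) :
    ∀ i, i ≤ L₃ δ → ∀ w ∈ Λ₃ δ, hexGraph.Adj (c₃ δ i) w →
      (1 ≤ i ∧ w = c₃ δ (i - 1)) ∨ (i < L₃ δ ∧ w = c₃ δ (i + 1)) ∨ (i = L₃ δ ∧ w = Xv δ) := by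
  intro i hi w hw h
  rcases mem_Λ₃.1 hw with ⟨j, hj, rfl⟩ | hw
  · rcases adj_c₃_imp δ h with h1 | h1
    · left; exact ⟨by omega, by rw [h1]; rfl⟩
    · right; left; exact ⟨by omega, by rw [h1]⟩
  · right; right; exact blob_adj_c₃ hδ hδ1 hi hw h

end Family3


/-! ### K.3 Walks through a bare root-attached corridor: the corridor is a forced prefix -/

section CorridorPrefix

variable {Λ B : Finset HexVertex} {u X : HexVertex} {c : ℕ → HexVertex} {L : ℕ} {z : Sym2 HexVertex}

/-- The inductive core: as long as a walk from the root has not ended, it follows the corridor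
`c 0, …, c L` and then steps onto `X`. -/
theorem corridor_claim (hu : u ∉ Λ)
    (hbare : ∀ i, i ≤ L → ∀ w ∈ Λ, hexGraph.Adj (c i) w →
      (1 ≤ i ∧ w = c (i - 1)) ∨ (i < L ∧ w = c (i + 1)) ∨ (i = L ∧ w = X))
    (γ : HexMidEdgeSAW Λ s(u, c 0) z) (hne : γ.verts ≠ []) :
    ∀ (j : ℕ) (hj : j < γ.verts.length), j ≤ L + 1 →
      (j ≤ L → γ.verts[j] = c j) ∧ (j = L + 1 → γ.verts[j] = X) := by
  set l := γ.verts with hl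
  have hn : 0 < l.length := List.length_pos_iff.2 hne
  have hmemΛ : ∀ (i : ℕ) (hi : i < l.length), l[i] ∈ Λ := fun i hi => γ.subset _ (List.getElem_mem _)
  have h0 : l[0] = c 0 := by
    have hmem := γ.head_mem (l.head hne) (List.head?_eq_some_head hne)
    rw [List.head_eq_getElem] at hmem
    rcases Sym2.mem_iff.1 hmem with h | h
    · exact absurd (h ▸ hmemΛ 0 hn) hu
    · exact h
  have hchain : ∀ (i : ℕ) (hi : i + 1 < l.length), hexGraph.Adj l[i] l[i + 1] :=
    fun i hi => List.isChain_iff_getElem.1 γ.isChain i hi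
  have hnod : ∀ (i j : ℕ) (hi : i < l.length) (hj : j < l.length), l[i] = l[j] → i = j :=
    fun i j hi hj h => (γ.nodup.getElem_inj_iff).1 h
  intro j
  induction j using Nat.strong_induction_on with
  | _ j ih =>
    intro hj hjL
    match j with
    | 0 => exact ⟨fun _ => h0, fun h => absurd h (by omega)⟩
    | j + 1 =>
      have hcj : l[j] = c j := (ih j (by omega) (by omega) (by omega)).1 (by omega)
      have hadj : hexGraph.Adj (c j) l[j + 1] := by
        have := hchain j hj
        rwa [hcj] at this
      rcases hbare j (by omega) _ (hmemΛ _ hj) hadj with ⟨hj1, h⟩ | ⟨hjL', h⟩ | ⟨hjL', h⟩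
      · exfalso
        have hprev : l[j - 1] = c (j - 1) :=
          (ih (j - 1) (by omega) (by omega) (by omega)).1 (by omega)
        have : l[j + 1] = l[j - 1] := by rw [h, hprev]
        have := hnod _ _ hj (by omega) this
        omega
      · exact ⟨fun _ => h, fun h' => absurd h' (by omega)⟩
      · exact ⟨fun h' => absurd h' (by omega), fun _ => h⟩

/-- **Forced prefix.** `c 0` is the root vertex (`s(u, c 0)` the root mid-edge, `u ∉ Λ`),
`c 0, …, c L` a corridor whose `Λ`-neighbours are corridor neighbours, except that `c L` has the
extra neighbour `X`; the target mid-edge `z` avoids the corridor. Then every self-avoiding walk from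
the root to `z` starts with `c 0, …, c L, X`. -/
theorem corridor_prefix (hu : u ∉ Λ)
    (hbare : ∀ i, i ≤ L → ∀ w ∈ Λ, hexGraph.Adj (c i) w →
      (1 ≤ i ∧ w = c (i - 1)) ∨ (i < L ∧ w = c (i + 1)) ∨ (i = L ∧ w = X))
    (hz : ∀ i, i ≤ L → c i ∉ z)
    (γ : HexMidEdgeSAW Λ s(u, c 0) z) :
    L + 2 ≤ γ.verts.length ∧
      (∀ (i : ℕ) (hi : i < γ.verts.length), i ≤ L → γ.verts[i] = c i) ∧
      ∀ hL : L + 1 < γ.verts.length, γ.verts[L + 1] = X := by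
  have hne : γ.verts ≠ [] := by
    intro h
    have := γ.eq_of_nil h
    exact hz 0 (Nat.zero_le _) (this ▸ Sym2.mem_mk_right u (c 0))
  have claim := corridor_claim hu hbare γ hne
  have hn : 0 < γ.verts.length := List.length_pos_iff.2 hne
  -- the walk cannot stop on the corridor
  have hlen : L + 2 ≤ γ.verts.length := by
    by_contra hcon
    have h1 : γ.verts.length - 1 < γ.verts.length := by omega
    have h2 : γ.verts.length - 1 ≤ L + 1 := by omega
    have h3 : γ.verts.length - 1 ≤ L := by omega
    have hlast := γ.getLast_mem (γ.verts.getLast hne) (List.getLast?_eq_some_getLast hne)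
    rw [List.getLast_eq_getElem] at hlast
    have heq : γ.verts[γ.verts.length - 1] = c (γ.verts.length - 1) := (claim _ h1 h2).1 h3
    rw [heq] at hlast
    exact hz (γ.verts.length - 1) h3 hlast
  exact ⟨hlen, fun i hi hiL => (claim i hi (by omega)).1 hiL,
    fun hL => (claim (L + 1) hL le_rfl).2 rfl⟩

/-- **Walks to a corridor mid-edge are unique**: the only self-avoiding walk from the root to the
mid-edge `{c k, c (k+1)}` (`k < L`) is `c 0, …, c k`. In particular `|F_{x,σ}| = x^{k+1}` there,
for every spin: no cancellation on a bare corridor. -/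
theorem corridor_edge_unique (hu : u ∉ Λ) (hcΛ : ∀ i, i ≤ L → c i ∈ Λ)
    (hinj : ∀ i j, i ≤ L → j ≤ L → c i = c j → i = j)
    (hbare : ∀ i, i ≤ L → ∀ w ∈ Λ, hexGraph.Adj (c i) w →
      (1 ≤ i ∧ w = c (i - 1)) ∨ (i < L ∧ w = c (i + 1)) ∨ (i = L ∧ w = X))
    {k : ℕ} (hk : k < L) (γ : HexMidEdgeSAW Λ s(u, c 0) s(c k, c (k + 1))) :
    γ.verts = (List.range (k + 1)).map c := by
  have hne : γ.verts ≠ [] := by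
    intro h
    have := γ.eq_of_nil h
    have hu' : u ∈ s(c k, c (k + 1)) := this ▸ Sym2.mem_mk_left u (c 0)
    rcases Sym2.mem_iff.1 hu' with h' | h'
    · exact hu (h' ▸ hcΛ k hk.le)
    · exact hu (h' ▸ hcΛ (k + 1) hk)
  have claim := corridor_claim hu hbare γ hne
  set l := γ.verts with hl
  have hn : 0 < l.length := List.length_pos_iff.2 hne
  have hnod : ∀ (i j : ℕ) (hi : i < l.length) (hj : j < l.length), l[i] = l[j] → i = j :=
    fun i j hi hj h => (γ.nodup.getElem_inj_iff).1 h
  have hlast := γ.getLast_mem (l.getLast hne) (List.getLast?_eq_some_getLast hne)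
  rw [List.getLast_eq_getElem] at hlast
  -- the walk ends at index `k`
  have hlenk : l.length = k + 1 := by
    rcases Nat.lt_or_ge (l.length - 1) (L + 1) with hsmall | hbig
    · have heq : l[l.length - 1] = c (l.length - 1) :=
        (claim (l.length - 1) (by omega) (by omega)).1 (by omega)
      rw [heq] at hlast
      rcases Sym2.mem_iff.1 hlast with h | h
      · have := hinj _ _ (by omega) (by omega) h; omega
      · have hlen2 : l.length = k + 2 := by have := hinj _ _ (by omega) (by omega) h; omega
        -- then the final mid-edge repeats the last traversed edge
        exfalso
        have hnd := γ.edges_nodup hne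
        rw [List.nodup_append] at hnd
        obtain ⟨-, -, hdis⟩ := hnd
        have hmem := last_pair_mem_edges (l := l) (i := k) (by omega) (by omega)
        have hk0 : l[k] = c k := (claim k (by omega) (by omega)).1 (by omega)
        have hk1 : l[k + 1] = c (k + 1) := (claim (k + 1) (by omega) (by omega)).1 (by omega)
        rw [hk0, hk1] at hmem
        exact hdis _ (List.mem_cons_of_mem _ hmem) _ (List.mem_singleton_self _) rfl
    · exfalso
      have hk0 : l[k] = c k := (claim k (by omega) (by omega)).1 (by omega)
      have hk1 : l[k + 1] = c (k + 1) := (claim (k + 1) (by omega) (by omega)).1 (by omega)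
      rcases Sym2.mem_iff.1 hlast with h | h
      · have := hnod _ _ (by omega) (by omega) (h.trans hk0.symm); omega
      · have := hnod _ _ (by omega) (by omega) (h.trans hk1.symm); omega
  apply List.ext_getElem (by simp [hlenk])
  intro i h1 h2
  simp only [List.getElem_map, List.getElem_range]
  exact (claim i h1 (by omega)).1 (by omega)

/-- On a bare corridor the observable of any spin has modulus exactly `x^{k+1}` at the mid-edge
`{c k, c (k+1)}`. -/
theorem norm_F_corridor_edge (hu : u ∉ Λ) (hcΛ : ∀ i, i ≤ L → c i ∈ Λ)
    (hinj : ∀ i j, i ≤ L → j ≤ L → c i = c j → i = j)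
    (hadj : ∀ i, i < L → hexGraph.Adj (c i) (c (i + 1))) (huc : hexGraph.Adj u (c 0))
    (hbare : ∀ i, i ≤ L → ∀ w ∈ Λ, hexGraph.Adj (c i) w →
      (1 ≤ i ∧ w = c (i - 1)) ∨ (i < L ∧ w = c (i + 1)) ∨ (i = L ∧ w = X))
    {k : ℕ} (hk : k < L) {x : ℝ} (hx : 0 ≤ x) (σ : ℝ) :
    ‖hexParafermionicObservable Λ s(u, c 0) x σ s(c k, c (k + 1))‖ = x ^ (k + 1) := by
  -- the corridor walk to `{c k, c (k+1)}`
  let γ₀ : HexMidEdgeSAW Λ s(u, c 0) s(c k, c (k + 1)) :=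
    mkSAW Λ u (c 0) s(c k, c (k + 1)) ((List.range (k + 1)).map c) (by simp)
      (by
        intro v hv
        simp only [List.mem_map, List.mem_range] at hv
        obtain ⟨i, hi, rfl⟩ := hv
        exact hcΛ i (by omega))
      (by
        refine List.Nodup.map_on ?_ List.nodup_range
        intro i hi j hj h
        simp only [List.mem_range] at hi hj
        exact hinj i j (by omega) (by omega) h)
      (by
        refine List.isChain_iff_getElem.2 ?_
        intro i hi
        simp only [List.length_map, List.length_range] at hi
        simp only [List.getElem_map, List.getElem_range]
        exact hadj i (by omega))
      (by simp [List.range_succ_eq_map])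
      (by
        rw [List.getLast_eq_getElem]
        simp [List.getElem_map, List.getElem_range])
      huc (hcΛ 0 (Nat.zero_le _))
      (by
        simp only [List.mem_map, List.mem_range, not_exists, not_and]
        intro i hi h
        exact hu (h ▸ hcΛ i (by omega)))
      ⟨c (k + 1), Sym2.mem_mk_right _ _, by
        simp only [List.mem_map, List.mem_range, not_exists, not_and]
        intro i hi h
        have := hinj i (k + 1) (by omega) (by omega) h
        omega⟩
      (by
        intro h
        have hu' : u ∈ s(c k, c (k + 1)) := h ▸ Sym2.mem_mk_left u (c 0)
        rcases Sym2.mem_iff.1 hu' with h' | h'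
        · exact hu (h' ▸ hcΛ k hk.le)
        · exact hu (h' ▸ hcΛ (k + 1) hk))
  have huniq : ∀ γ : HexMidEdgeSAW Λ s(u, c 0) s(c k, c (k + 1)), γ = γ₀ := fun γ =>
    HexMidEdgeSAW.ext (by
      rw [corridor_edge_unique hu hcΛ hinj hbare hk γ]; rfl)
  letI : Unique (HexMidEdgeSAW Λ s(u, c 0) s(c k, c (k + 1))) := ⟨⟨γ₀⟩, huniq⟩
  rw [hexParafermionicObservable, Fintype.sum_unique, HexMidEdgeSAW.norm_weight _ hx]
  have : (default : HexMidEdgeSAW Λ s(u, c 0) s(c k, c (k + 1))) = γ₀ := huniq _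
  rw [this]
  show x ^ ((List.range (k + 1)).map c).length = x ^ (k + 1)
  simp

/-- The remainder of a walk after the forced corridor prefix, as a walk of the blob `B` from the
entry mid-edge `s(c L, X)`; here `Λ ⊆ corridor ∪ B`, `X ∈ B`, and `z` has an endpoint off `Λ`. -/
def restWalk (hu : u ∉ Λ)
    (hbare : ∀ i, i ≤ L → ∀ w ∈ Λ, hexGraph.Adj (c i) w →
      (1 ≤ i ∧ w = c (i - 1)) ∨ (i < L ∧ w = c (i + 1)) ∨ (i = L ∧ w = X))
    (hz : ∀ i, i ≤ L → c i ∉ z) (hz' : ∃ t ∈ z, t ∉ Λ)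
    (hΛ : ∀ w ∈ Λ, (∃ i, i ≤ L ∧ c i = w) ∨ w ∈ B) (hX : X ∈ B) (hcX : hexGraph.Adj (c L) X)
    (γ : HexMidEdgeSAW Λ s(u, c 0) z) : HexMidEdgeSAW B s(c L, X) z :=
  have hp := corridor_prefix hu hbare hz γ
  mkSAW B (c L) X z (γ.verts.drop (L + 1))
    (by
      intro h
      have := List.drop_eq_nil_iff.1 h
      have := hp.1; omega)
    (by
      intro v hv
      rw [List.mem_iff_getElem] at hv
      obtain ⟨k, hk, rfl⟩ := hv
      rw [List.length_drop] at hk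
      have hlt : L + 1 + k < γ.verts.length := by omega
      rw [List.getElem_drop]
      rcases hΛ _ (γ.subset _ (List.getElem_mem hlt)) with ⟨i, hi, hci⟩ | h
      · exfalso
        have h1 : γ.verts[i]'(by omega) = c i := hp.2.1 i (by omega) hi
        have := (γ.nodup.getElem_inj_iff).1 (h1.trans hci)
        omega
      · exact h)
    ((γ.nodup.sublist (List.drop_sublist _ _)))
    (γ.isChain.drop _)
    (by rw [List.head_drop]; exact hp.2.2 _)
    (by
      rw [List.getLast_drop]
      exact γ.getLast_mem _ (List.getLast?_eq_some_getLast _))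
    hcX hX
    (by
      intro h
      rw [List.mem_iff_getElem] at h
      obtain ⟨k, hk, hck⟩ := h
      rw [List.getElem_drop] at hck
      rw [List.length_drop] at hk
      have h1 : γ.verts[L]'(by have := hp.1; omega) = c L := hp.2.1 L _ le_rfl
      have := (γ.nodup.getElem_inj_iff).1 (h1.trans hck.symm)
      omega)
    (by
      obtain ⟨t, ht, htΛ⟩ := hz'
      exact ⟨t, ht, fun h => htΛ (γ.subset _ (List.mem_of_mem_drop h))⟩)
    (fun h => hz L le_rfl (h ▸ Sym2.mem_mk_left (c L) X))

theorem restWalk_verts (hu : u ∉ Λ)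
    (hbare : ∀ i, i ≤ L → ∀ w ∈ Λ, hexGraph.Adj (c i) w →
      (1 ≤ i ∧ w = c (i - 1)) ∨ (i < L ∧ w = c (i + 1)) ∨ (i = L ∧ w = X))
    (hz : ∀ i, i ≤ L → c i ∉ z) (hz' : ∃ t ∈ z, t ∉ Λ)
    (hΛ : ∀ w ∈ Λ, (∃ i, i ≤ L ∧ c i = w) ∨ w ∈ B) (hX : X ∈ B) (hcX : hexGraph.Adj (c L) X)
    (γ : HexMidEdgeSAW Λ s(u, c 0) z) :
    (restWalk hu hbare hz hz' hΛ hX hcX γ).verts = γ.verts.drop (L + 1) := rfl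

/-- The length splits: `ℓ(γ) = (L + 1) + ℓ(rest)`. -/
theorem length_eq_restWalk (hu : u ∉ Λ)
    (hbare : ∀ i, i ≤ L → ∀ w ∈ Λ, hexGraph.Adj (c i) w →
      (1 ≤ i ∧ w = c (i - 1)) ∨ (i < L ∧ w = c (i + 1)) ∨ (i = L ∧ w = X))
    (hz : ∀ i, i ≤ L → c i ∉ z) (hz' : ∃ t ∈ z, t ∉ Λ)
    (hΛ : ∀ w ∈ Λ, (∃ i, i ≤ L ∧ c i = w) ∨ w ∈ B) (hX : X ∈ B) (hcX : hexGraph.Adj (c L) X)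
    (γ : HexMidEdgeSAW Λ s(u, c 0) z) :
    γ.length = (L + 1) + (restWalk hu hbare hz hz' hΛ hX hcX γ).length := by
  have hp := corridor_prefix hu hbare hz γ
  unfold HexMidEdgeSAW.length
  rw [restWalk_verts, List.length_drop]
  omega

/-- The remainder determines the walk. -/
theorem restWalk_injective (hu : u ∉ Λ)
    (hbare : ∀ i, i ≤ L → ∀ w ∈ Λ, hexGraph.Adj (c i) w →
      (1 ≤ i ∧ w = c (i - 1)) ∨ (i < L ∧ w = c (i + 1)) ∨ (i = L ∧ w = X))
    (hz : ∀ i, i ≤ L → c i ∉ z) (hz' : ∃ t ∈ z, t ∉ Λ)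
    (hΛ : ∀ w ∈ Λ, (∃ i, i ≤ L ∧ c i = w) ∨ w ∈ B) (hX : X ∈ B) (hcX : hexGraph.Adj (c L) X) :
    Function.Injective (restWalk hu hbare hz hz' hΛ hX hcX) := by
  intro γ₁ γ₂ h
  have h' := congrArg HexMidEdgeSAW.verts h
  rw [restWalk_verts, restWalk_verts] at h'
  have hp₁ := corridor_prefix hu hbare hz γ₁
  have hp₂ := corridor_prefix hu hbare hz γ₂
  apply HexMidEdgeSAW.ext
  have hlen : γ₁.verts.length = γ₂.verts.length := by
    have := congrArg List.length h'
    rw [List.length_drop, List.length_drop] at this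
    omega
  apply List.ext_getElem hlen
  intro i h1 h2
  rcases Nat.lt_or_ge i (L + 1) with hi | hi
  · rw [hp₁.2.1 i h1 (by omega), hp₂.2.1 i h2 (by omega)]
  · have e1 : γ₁.verts[i] = (γ₁.verts.drop (L + 1))[i - (L + 1)]'(by rw [List.length_drop]; omega) := by
      rw [List.getElem_drop]; congr 1; omega
    have e2 : γ₂.verts[i] = (γ₂.verts.drop (L + 1))[i - (L + 1)]'(by rw [List.length_drop]; omega) := by
      rw [List.getElem_drop]; congr 1; omega
    rw [e1, e2]
    simp only [h']

/-- **Mass transfer through the corridor.** The mass from the root to `z` in `Λ` is at most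
`x^{L+1}` times the mass from the entry mid-edge `s(c L, X)` to `z` inside the blob `B`; the same
bound holds for `|F_{x,σ}|` at any spin. -/
theorem norm_F_le_corridor_blob (hu : u ∉ Λ)
    (hbare : ∀ i, i ≤ L → ∀ w ∈ Λ, hexGraph.Adj (c i) w →
      (1 ≤ i ∧ w = c (i - 1)) ∨ (i < L ∧ w = c (i + 1)) ∨ (i = L ∧ w = X))
    (hz : ∀ i, i ≤ L → c i ∉ z) (hz' : ∃ t ∈ z, t ∉ Λ)
    (hΛ : ∀ w ∈ Λ, (∃ i, i ≤ L ∧ c i = w) ∨ w ∈ B) (hX : X ∈ B) (hcX : hexGraph.Adj (c L) X)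
    {x : ℝ} (hx : 0 ≤ x) (σ : ℝ) :
    ‖hexParafermionicObservable Λ s(u, c 0) x σ z‖ ≤
      x ^ (L + 1) * ‖hexParafermionicObservable B s(c L, X) x 0 z‖ := by
  classical
  set R := restWalk hu hbare hz hz' hΛ hX hcX with hR
  calc ‖hexParafermionicObservable Λ s(u, c 0) x σ z‖
      ≤ ∑ γ : HexMidEdgeSAW Λ s(u, c 0) z, x ^ γ.length :=
        norm_hexParafermionicObservable_le _ _ hx _ _
    _ = ∑ γ : HexMidEdgeSAW Λ s(u, c 0) z, x ^ (L + 1) * x ^ (R γ).length := by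
        refine Finset.sum_congr rfl fun γ _ => ?_
        rw [← pow_add, ← length_eq_restWalk hu hbare hz hz' hΛ hX hcX γ]
    _ = x ^ (L + 1) * ∑ γ : HexMidEdgeSAW Λ s(u, c 0) z, x ^ (R γ).length := by
        rw [Finset.mul_sum]
    _ ≤ x ^ (L + 1) * ∑ γ' : HexMidEdgeSAW B s(c L, X) z, x ^ γ'.length := by
        refine mul_le_mul_of_nonneg_left ?_ (pow_nonneg hx _)
        have hinj := restWalk_injective hu hbare hz hz' hΛ hX hcX
        calc ∑ γ : HexMidEdgeSAW Λ s(u, c 0) z, x ^ (R γ).length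
            = ∑ γ' ∈ (Finset.univ.image R), x ^ γ'.length := by
              rw [Finset.sum_image (fun a _ b _ h => hinj h)]
          _ ≤ ∑ γ' : HexMidEdgeSAW B s(c L, X) z, x ^ γ'.length :=
              Finset.sum_le_sum_of_subset_of_nonneg (Finset.subset_univ _)
                fun _ _ _ => pow_nonneg hx _
    _ = x ^ (L + 1) * ‖hexParafermionicObservable B s(c L, X) x 0 z‖ := by
        rw [norm_Z_eq_sum _ _ _ hx]

end CorridorPrefix


/-! ### K.4 The blob is a piece of a DCS strip: `Z_Blob(entry → b) ≤ B_{T,L}(x_c) ≤ 1` -/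

section StripGlue

open Literature.Probability.RandomPlanarGeometry.SAW.HV

variable {δ : ℝ}

/-- The chart: honeycomb coordinates, central flip, then a translation taking the last corridor
vertex to `wOut` and the entry vertex `X` to the origin; it turns the blob upside down into the
strip `S_{T,L}` (`T = iK + 2`) with `b_δ` on the far side `β`. -/
noncomputable def Φ₃ (δ : ℝ) : hexGraph ≃g hvGraph :=
  hvIso.trans (flip.trans (shift (X₁ δ) (rT δ)))

theorem Φ₃_apply (δ : ℝ) (v : HexVertex) :
    Φ₃ δ v = (X₁ δ - xz v, rT δ - row v - 1, !decide (v.2 = 1)) := by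
  obtain ⟨y, i⟩ := v
  show shift (X₁ δ) (rT δ) (flip (toHV (y, i))) = _
  simp only [toHV, flip_apply, shift_apply, xz, row]
  refine Prod.ext ?_ (Prod.ext ?_ rfl)
  · dsimp only; ring
  · dsimp only; ring

theorem Φ₃_bv_even {r p : ℤ} (h : (p - r) % 2 = 0) :
    Φ₃ δ (bv r p) = (X₁ δ - (p - r) / 2, rT δ - r - 1, true) := by
  rw [Φ₃_apply, xz_bv, row_bv, h, sub_zero]
  simp [bv, h]

theorem Φ₃_bv_odd {r p : ℤ} (h : (p - r) % 2 = 1) :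
    Φ₃ δ (bv r p) = (X₁ δ - (p - r - 1) / 2, rT δ - r - 1, false) := by
  rw [Φ₃_apply, xz_bv, row_bv, h]
  simp [bv, h]

theorem c₃_L₃' (hδ : 0 < δ) (hδ1 : δ ≤ 1 / 100) : c₃ δ (L₃ δ) = bv (rT δ) (pE δ) := by
  rw [c₃_L₃]; congr 1; have := J_eq hδ hδ1; omega

theorem Φ₃_cL (hδ : 0 < δ) (hδ1 : δ ≤ 1 / 100) : Φ₃ δ (c₃ δ (L₃ δ)) = wOut := by
  rw [c₃_L₃' hδ hδ1, Φ₃_bv_even (by unfold pE rT; omega)]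
  unfold pE rT wOut
  refine Prod.ext ?_ (Prod.ext ?_ rfl)
  · dsimp only; omega
  · dsimp only; omega

theorem Φ₃_Xv (δ : ℝ) : Φ₃ δ (Xv δ) = hvOrigin := by
  rw [Xv, Φ₃_bv_odd (by unfold pE; omega)]
  unfold pE rT hvOrigin
  refine Prod.ext ?_ (Prod.ext ?_ rfl)
  · dsimp only; omega
  · dsimp only; omega

theorem bit_nonneg_le (v : HV) : 0 ≤ bit v ∧ bit v ≤ 1 := by
  unfold bit; split <;> simp

/-- The flipped blob lies in the strip `S_{T,L}` with `T = iK + 2`, `L = X₂ - X₁`. -/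
theorem Φ₃_mem_stripV (hδ : 0 < δ) (hδ1 : δ ≤ 1 / 100) {w : HexVertex} (hw : w ∈ Blob δ) :
    Φ₃ δ w ∈ stripV (iK δ + 2) (X₂ δ - X₁ δ).toNat := by
  obtain ⟨h12, -⟩ := params₃ hδ hδ1
  rw [mem_Blob] at hw
  obtain ⟨h1, h2, h3, h4⟩ := hw
  rw [Φ₃_apply, mem_stripV_iff]
  generalize (!decide (w.2 = 1)) = β
  have : ((X₂ δ - X₁ δ).toNat : ℤ) = X₂ δ - X₁ δ := by omega
  unfold rT
  cases β <;> simp only [lev_mk, bit_true, bit_false] <;> push_cast <;> omega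

/-- **The mass through the blob is at most one.** Walks inside the blob from the entry mid-edge
`{c_L, X}` to `b_δ` are, after the chart `Φ₃`, self-avoiding walks of the DCS strip domain
`S_{T,L}` from `a` to the far side `β`; hence their total critical weight is at most
`B_{T,L}(x_c) ≤ 1` (Duminil-Copin–Smirnov, Lemma 2). -/
theorem norm_Z_blob_le_one (hδ : 0 < δ) (hδ1 : δ ≤ 1 / 100) :
    ‖hexParafermionicObservable (Blob δ) s(c₃ δ (L₃ δ), Xv δ) hexCriticalFugacity 0 (bE δ)‖ ≤ 1 := by
  classical
  obtain ⟨h12, hfar, hPP, hb1, hb2, -⟩ := params₃ hδ hδ1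
  have hpb := pB_mod δ
  set T : ℕ := iK δ + 2 with hT
  set Lb : ℕ := (X₂ δ - X₁ δ).toNat with hLb
  set wb : HexVertex := bv (mRow δ) (pB δ) with hwb
  set ub : HexVertex := bv (mRow δ - 1) (pB δ) with hub
  have hbE : bE δ = s(wb, ub) := rfl
  have hx0 : (0:ℝ) ≤ hexCriticalFugacity := hexCriticalFugacity_pos_lt_one.1.le
  have hubB : ub ∉ Blob δ := by rw [hub, bv_mem_Blob]; omega
  have hcL : c₃ δ (L₃ δ) ∉ Blob δ := c₃_not_mem_Blob hδ hδ1 _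
  have hvt : hexGraph.Adj wb ub := (adj_bE δ).symm
  have hΦu := Φ₃_cL hδ hδ1
  have hΦw := Φ₃_Xv δ
  -- images of the two endpoints of `b_δ`
  have hxb : (pB δ - mRow δ) % 2 = 0 := by omega
  have hΦwb : Φ₃ δ wb = (X₁ δ - (pB δ - mRow δ) / 2, (iK δ : ℤ) + 1, true) := by
    rw [hwb, Φ₃_bv_even hxb]; unfold rT
    refine Prod.ext rfl (Prod.ext ?_ rfl)
    dsimp only; omega
  have hΦub : Φ₃ δ ub = (X₁ δ - (pB δ - mRow δ) / 2, (iK δ : ℤ) + 2, false) := by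
    rw [hub, Φ₃_bv_odd (by omega)]; unfold rT
    refine Prod.ext ?_ (Prod.ext ?_ rfl)
    · dsimp only; omega
    · dsimp only; omega
  -- every walk ends at `wb` (the endpoint of `b_δ` inside the blob) and is nontrivial
  have hne : ∀ γ : HexMidEdgeSAW (Blob δ) s(c₃ δ (L₃ δ), Xv δ) (bE δ), γ.verts ≠ [] := by
    intro γ h
    have := γ.eq_of_nil h
    rw [hbE, Sym2.eq_iff] at this
    rcases this with ⟨h1, -⟩ | ⟨h1, -⟩
    · have := congrArg row h1
      rw [c₃_L₃' hδ hδ1, row_bv, hwb, row_bv] at this; unfold rT at this; omega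
    · have := congrArg row h1
      rw [c₃_L₃' hδ hδ1, row_bv, hub, row_bv] at this; unfold rT at this; omega
  have hlast : ∀ γ : HexMidEdgeSAW (Blob δ) s(c₃ δ (L₃ δ), Xv δ) (bE δ),
      γ.verts.getLast (hne γ) = wb := by
    intro γ
    rcases γ.getLast_eq_or (hne γ) with h | h
    · exact h
    · exfalso
      apply hubB
      rw [hub, ← h]
      exact γ.subset _ (List.getLast_mem (hne γ))
  -- the code of a walk
  set code : HexMidEdgeSAW (Blob δ) s(c₃ δ (L₃ δ), Xv δ) (bE δ) → List HV :=
    fun γ => wOut :: (γ.verts.map (Φ₃ δ) ++ [Φ₃ δ ub]) with hcode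
  have hmid : ∀ γ, IsMidWalk (stripV T Lb) (code γ) := by
    intro γ
    have h := HexMidEdgeSAW.isMidWalk_code (Φ₃ δ) γ rfl hcL hΦu hΦw hvt (hne γ)
      (Or.inl ⟨hlast γ, rfl⟩)
    refine h.mono ?_
    intro y hy
    obtain ⟨w, hw, rfl⟩ := Finset.mem_map.1 hy
    exact Φ₃_mem_stripV hδ hδ1 hw
  have hbeta : ∀ γ, IsBetaDart T (finalDart (code γ)) := by
    intro γ
    have hne' : γ.verts.map (Φ₃ δ) ≠ [] := by simpa using hne γ
    simp only [hcode]
    rw [finalDart_cons_append hne', List.getLast_map hne', hlast γ, hΦwb, hΦub]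
    refine ⟨?_, rfl, ?_⟩
    · show ((iK δ : ℤ) + 1) = ((T : ℕ) : ℤ) - 1
      rw [hT]; push_cast; ring
    · exact Prod.ext rfl (Prod.ext (by dsimp only; ring) rfl)
  have hmem : ∀ γ ∈ (Finset.univ : Finset (HexMidEdgeSAW (Blob δ) s(c₃ δ (L₃ δ), Xv δ) (bE δ))),
      code γ ∈ (midWalks (stripV T Lb)).filter (fun P => IsBetaDart T (finalDart P)) :=
    fun γ _ => Finset.mem_filter.2 ⟨mem_midWalks_iff.2 (hmid γ), hbeta γ⟩
  have hinj : Set.InjOn code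
      (↑(Finset.univ : Finset (HexMidEdgeSAW (Blob δ) s(c₃ δ (L₃ δ), Xv δ) (bE δ))) : Set _) := by
    intro γ₁ _ γ₂ _ h
    simp only [hcode] at h
    have h1 := List.cons_injective h
    have h2 := List.append_cancel_right h1
    exact HexMidEdgeSAW.ext ((List.map_injective_iff.2 (Φ₃ δ).injective) h2)
  have hlen : ∀ γ : HexMidEdgeSAW (Blob δ) s(c₃ δ (L₃ δ), Xv δ) (bE δ),
      mwLen (code γ) = γ.length := by
    intro γ; simp only [hcode]; rw [mwLen_cons_append, List.length_map]; rfl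
  -- compare with `B_{T,L}(x_c) ≤ 1`
  calc ‖hexParafermionicObservable (Blob δ) s(c₃ δ (L₃ δ), Xv δ) hexCriticalFugacity 0 (bE δ)‖
      = ∑ γ : HexMidEdgeSAW (Blob δ) s(c₃ δ (L₃ δ), Xv δ) (bE δ),
          hexCriticalFugacity ^ γ.length := norm_Z_eq_sum _ _ _ hx0
    _ = ∑ γ : HexMidEdgeSAW (Blob δ) s(c₃ δ (L₃ δ), Xv δ) (bE δ),
          hexCriticalFugacity ^ mwLen (code γ) := by
        refine Finset.sum_congr rfl fun γ _ => by rw [hlen]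
    _ ≤ ∑ P ∈ (midWalks (stripV T Lb)).filter (fun P => IsBetaDart T (finalDart P)),
          hexCriticalFugacity ^ mwLen P :=
        sum_le_sum_of_injOn_of_nonneg code hinj hmem (fun P => hexCriticalFugacity ^ mwLen P)
          fun _ _ => pow_nonneg hx0 _
    _ = stripB T Lb hexCriticalFugacity := rfl
    _ ≤ 1 := stripB_le_one_of_lemma2 DuminilCopinSmirnov2012_lemma2_holds (by omega) Lb

end StripGlue


/-! ### K.5 The hypothesis frame of `Λ₃` (everything except exhaustion) -/

/-- **`Nonempty` SAW is decoration**: in a connected domain, any two distinct boundary mid-edges are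
joined by a self-avoiding walk (take a path in the induced graph). -/
theorem nonempty_saw_of_preconnected {Λ : Finset HexVertex}
    (hpre : (hexGraph.induce ((Λ : Finset HexVertex) : Set HexVertex)).Preconnected)
    {u w w' u' : HexVertex} (huw : hexGraph.Adj u w) (hu : u ∉ Λ) (hw : w ∈ Λ)
    (hw' : w' ∈ Λ) (hu' : u' ∉ Λ) (hne : s(u, w) ≠ s(w', u')) :
    Nonempty (HexMidEdgeSAW Λ s(u, w) s(w', u')) := by
  classical
  obtain ⟨p⟩ := hpre ⟨w, Finset.mem_coe.2 hw⟩ ⟨w', Finset.mem_coe.2 hw'⟩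
  have hqp : p.bypass.IsPath := p.bypass_isPath
  set l : List HexVertex := p.bypass.support.map Subtype.val with hl
  have hlne : l ≠ [] := by simp [hl, SimpleGraph.Walk.support_ne_nil]
  refine ⟨mkSAW Λ u w s(w', u') l hlne ?_ ?_ ?_ ?_ ?_ huw hw ?_ ?_ hne⟩
  · intro v hv
    obtain ⟨x, -, rfl⟩ := List.mem_map.1 hv
    exact Finset.mem_coe.1 x.2
  · exact hqp.support_nodup.map Subtype.val_injective
  · rw [hl, List.isChain_map]
    exact List.IsChain.imp (fun a b h => by simpa [SimpleGraph.comap_adj] using h)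
      p.bypass.isChain_adj_support
  · simp [hl]
  · have : l.getLast hlne = w' := by simp [hl, List.getLast_map]
    rw [this]; exact Sym2.mem_mk_left _ _
  · intro h
    obtain ⟨x, -, hx⟩ := List.mem_map.1 h
    exact hu (hx ▸ Finset.mem_coe.1 x.2)
  · exact ⟨u', Sym2.mem_mk_right _ _, fun h => by
      obtain ⟨x, -, hx⟩ := List.mem_map.1 h
      exact hu' (hx ▸ Finset.mem_coe.1 x.2)⟩

section Frame3

variable {δ : ℝ}

theorem Λ₃_subset_ΛR (hδ : 0 < δ) (hδ1 : δ ≤ 1 / 100) : Λ₃ δ ⊆ ΛR δ := by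
  obtain ⟨hiM, hM0, hm10, hPa, hpa, hpb, hbP, hP100, -⟩ := params hδ hδ1
  obtain ⟨h12, hfar, hPP, -, -, hJ2, hJ0⟩ := params₃ hδ hδ1
  have hJ := J_eq hδ hδ1
  intro v hv
  rw [← bv_row_pos v, bv_mem_ΛR]
  rcases mem_Λ₃.1 hv with ⟨i, hi, rfl⟩ | hw
  · unfold L₃ at hi
    rcases c₃_coords δ i with ⟨hi', r1, p1⟩ | ⟨hi', r1, p1⟩
    · rw [r1, p1]; unfold I₀ at *; omega
    · rw [r1, p1]; unfold I₀ pE at *; omega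
  · rw [mem_Blob] at hw
    have hx := two_xz v
    unfold pE at *
    omega

theorem inside_Λ₃ (hδ : 0 < δ) (hδ1 : δ ≤ 1 / 100) :
    ∀ v ∈ Λ₃ δ, (δ : ℂ) * hexCenter v ∈ D₀.carrier :=
  fun v hv => inside_ΛR hδ hδ1 v (Λ₃_subset_ΛR hδ hδ1 hv)

/-- Vertices below the bottom row are off `Λ₃`. -/
theorem bv_not_mem_Λ₃_of_row_lt {r p : ℤ} (hr : r < mRow δ) : bv r p ∉ Λ₃ δ := by
  intro h
  rcases mem_Λ₃.1 h with ⟨i, -, hi⟩ | hw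
  · have := congrArg row hi
    rw [row_c₃, row_bv] at this; omega
  · rw [bv_mem_Blob] at hw; omega

theorem aE_eq₃ (δ : ℝ) : aE δ = s(bv (mRow δ - 1) (pA δ), c₃ δ 0) := by rw [c₃_zero]; rfl

theorem aE_mem_boundary₃ (δ : ℝ) : aE δ ∈ hexDomainBoundary (Λ₃ δ) :=
  ⟨(SimpleGraph.mem_edgeSet _).2 (adj_aE δ), bv (mRow δ - 1) (pA δ), bv (mRow δ) (pA δ), rfl,
    c₃_zero δ ▸ c₃_mem δ (Nat.zero_le _), bv_not_mem_Λ₃_of_row_lt (by omega)⟩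

theorem wb_mem_Blob (hδ : 0 < δ) (hδ1 : δ ≤ 1 / 100) : bv (mRow δ) (pB δ) ∈ Blob δ := by
  obtain ⟨h12, hfar, hPP, hb1, hb2, -⟩ := params₃ hδ hδ1
  have := pB_mod δ
  rw [bv_mem_Blob]; omega

theorem bE_mem_boundary₃ (hδ : 0 < δ) (hδ1 : δ ≤ 1 / 100) : bE δ ∈ hexDomainBoundary (Λ₃ δ) :=
  ⟨(SimpleGraph.mem_edgeSet _).2 (adj_bE δ).symm, bv (mRow δ - 1) (pB δ), bv (mRow δ) (pB δ),
    Sym2.eq_swap, mem_Λ₃.2 (Or.inr (wb_mem_Blob hδ hδ1)), bv_not_mem_Λ₃_of_row_lt (by omega)⟩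

/-! #### Connectedness of `Λ₃` -/

theorem linked_c₃ (δ : ℝ) (i n : ℕ) (h : i + n ≤ L₃ δ) :
    Linked (↑(Λ₃ δ) : Set HexVertex) (c₃ δ i) (c₃ δ (i + n)) := by
  induction n with
  | zero => exact Linked.refl (Finset.mem_coe.2 (c₃_mem δ (by omega)))
  | succ n ih =>
    exact (ih (by omega)).trans (linked_of_adj (Finset.mem_coe.2 (c₃_mem δ (by omega)))
      (Finset.mem_coe.2 (c₃_mem δ h)) (adj_c₃ δ (i + n)))

/-- Inside the blob: every vertex is linked to the left end of its row. -/
theorem linked_blob_row {w : HexVertex} (hw : w ∈ Blob δ) :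
    Linked (↑(Λ₃ δ) : Set HexVertex) w (bv (row w) (2 * X₁ δ + row w)) := by
  have hw' := hw
  rw [mem_Blob] at hw'
  have hx := two_xz w
  have h := linked_run' (S := (↑(Λ₃ δ) : Set HexVertex)) (row w) (2 * X₁ δ + row w) (pos w) (by omega)
    (by
      intro t ht1 ht2
      refine Finset.mem_coe.2 (mem_Λ₃.2 (Or.inr ?_))
      rw [bv_mem_Blob]; omega)
  rw [bv_row_pos] at h
  exact h.symm

/-- Inside the blob: the left ends of the rows are linked down to the bottom-left corner. -/
theorem linked_blob_descend (hδ : 0 < δ) (hδ1 : δ ≤ 1 / 100) (n : ℕ) (hn : (n : ℤ) ≤ iK δ + 1) :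
    Linked (↑(Λ₃ δ) : Set HexVertex) (bv (mRow δ + n) (2 * X₁ δ + mRow δ + n))
      (bv (mRow δ) (2 * X₁ δ + mRow δ)) := by
  obtain ⟨h12, -⟩ := params₃ hδ hδ1
  induction n with
  | zero =>
    simp only [Nat.cast_zero, add_zero]
    refine Linked.refl (Finset.mem_coe.2 (mem_Λ₃.2 (Or.inr ?_)))
    rw [bv_mem_Blob]; omega
  | succ n ih =>
    have m1 : bv (mRow δ + (n + 1 : ℕ)) (2 * X₁ δ + mRow δ + (n + 1 : ℕ)) ∈ Λ₃ δ := by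
      refine mem_Λ₃.2 (Or.inr ?_); rw [bv_mem_Blob]; push_cast; omega
    have m2 : bv (mRow δ + n) (2 * X₁ δ + mRow δ + (n + 1 : ℕ)) ∈ Λ₃ δ := by
      refine mem_Λ₃.2 (Or.inr ?_); rw [bv_mem_Blob]; push_cast; omega
    have m3 : bv (mRow δ + n) (2 * X₁ δ + mRow δ + n) ∈ Λ₃ δ := by
      refine mem_Λ₃.2 (Or.inr ?_); rw [bv_mem_Blob]; omega
    have a1 : hexGraph.Adj (bv (mRow δ + (n + 1 : ℕ)) (2 * X₁ δ + mRow δ + (n + 1 : ℕ)))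
        (bv (mRow δ + n) (2 * X₁ δ + mRow δ + (n + 1 : ℕ))) := by
      rw [adj_bv_iff]; right; left; push_cast; exact ⟨rfl, by ring, by omega⟩
    have a2 : hexGraph.Adj (bv (mRow δ + n) (2 * X₁ δ + mRow δ + (n + 1 : ℕ)))
        (bv (mRow δ + n) (2 * X₁ δ + mRow δ + n)) := by
      rw [adj_bv_iff]; left; push_cast; exact ⟨rfl, Or.inr (by ring)⟩
    exact ((linked_of_adj (Finset.mem_coe.2 m1) (Finset.mem_coe.2 m2) a1).trans
      (linked_of_adj (Finset.mem_coe.2 m2) (Finset.mem_coe.2 m3) a2)).trans (ih (by omega))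

/-- Every vertex of `Λ₃` is linked inside `Λ₃` to the blob's bottom-left corner. -/
theorem linked_Λ₃ (hδ : 0 < δ) (hδ1 : δ ≤ 1 / 100) {v : HexVertex} (hv : v ∈ Λ₃ δ) :
    Linked (↑(Λ₃ δ) : Set HexVertex) v (bv (mRow δ) (2 * X₁ δ + mRow δ)) := by
  -- blob vertices
  have hblob : ∀ w ∈ Blob δ, Linked (↑(Λ₃ δ) : Set HexVertex) w (bv (mRow δ) (2 * X₁ δ + mRow δ)) := by
    intro w hw
    have h1 := linked_blob_row hw
    have hw' := hw
    rw [mem_Blob] at hw'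
    obtain ⟨n, hn⟩ : ∃ n : ℕ, row w = mRow δ + n := ⟨(row w - mRow δ).toNat, by omega⟩
    have h2 := linked_blob_descend hδ hδ1 n (by omega)
    rw [← hn, show 2 * X₁ δ + mRow δ + (n : ℤ) = 2 * X₁ δ + row w by omega] at h2
    exact h1.trans h2
  rcases mem_Λ₃.1 hv with ⟨i, hi, rfl⟩ | hw
  · -- along the corridor to its end, then onto `X`
    have h1 := linked_c₃ δ i (L₃ δ - i) (by omega)
    rw [show i + (L₃ δ - i) = L₃ δ by omega] at h1
    have h2 : Linked (↑(Λ₃ δ) : Set HexVertex) (c₃ δ (L₃ δ)) (Xv δ) :=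
      linked_of_adj (Finset.mem_coe.2 (c₃_mem δ le_rfl))
        (Finset.mem_coe.2 (mem_Λ₃.2 (Or.inr (Xv_mem_Blob hδ hδ1)))) (adj_c₃_Xv hδ hδ1)
    exact (h1.trans h2).trans (hblob _ (Xv_mem_Blob hδ hδ1))
  · exact hblob v hw

theorem preconnected_Λ₃ (hδ : 0 < δ) (hδ1 : δ ≤ 1 / 100) :
    (hexGraph.induce ((Λ₃ δ : Finset HexVertex) : Set HexVertex)).Preconnected :=
  preconnected_of_linked fun _ hu _ hv =>
    (linked_Λ₃ hδ hδ1 hu).trans (linked_Λ₃ hδ hδ1 hv).symm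

theorem nonempty_saw_Λ₃ (hδ : 0 < δ) (hδ1 : δ ≤ 1 / 100) :
    Nonempty (HexMidEdgeSAW (Λ₃ δ) (aE δ) (bE δ)) := by
  obtain ⟨-, -, -, -, hpa, hpb, -⟩ := params hδ hδ1
  refine nonempty_saw_of_preconnected (preconnected_Λ₃ hδ hδ1) (adj_aE δ)
    (bv_not_mem_Λ₃_of_row_lt (by omega)) (c₃_zero δ ▸ c₃_mem δ (Nat.zero_le _))
    (mem_Λ₃.2 (Or.inr (wb_mem_Blob hδ hδ1))) (bv_not_mem_Λ₃_of_row_lt (by omega)) ?_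
  intro h
  rcases Sym2.eq_iff.1 h with ⟨h1, -⟩ | ⟨-, h1⟩
  · have := (bv_inj h1).1; omega
  · have := (bv_inj h1).2; omega

/-! #### The rows clause in the quarter ball about `b`, and flatness there -/

theorem ball_quarter {z : ℂ} (hz : z ∈ Metric.ball (D₀.pt 1) (1 / 4)) :
    3 / 4 < z.re ∧ z.re < 5 / 4 ∧ -5 / 4 < z.im ∧ z.im < -3 / 4 := by
  rw [Metric.mem_ball, D₀_pt1, Complex.dist_eq] at hz
  have h1 : |(z - ⟨1, -1⟩ : ℂ).re| < 1 / 4 := lt_of_le_of_lt (Complex.abs_re_le_norm _) hz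
  have h2 : |(z - ⟨1, -1⟩ : ℂ).im| < 1 / 4 := lt_of_le_of_lt (Complex.abs_im_le_norm _) hz
  simp only [Complex.sub_re, Complex.sub_im] at h1 h2
  rw [abs_lt] at h1 h2
  refine ⟨by linarith, by linarith, by linarith, by linarith⟩

theorem D₀_flat_quarter : D₀.carrier ∩ Metric.ball (D₀.pt 1) (1 / 4) =
    {z : ℂ | (D₀.pt 1).im < z.im} ∩ Metric.ball (D₀.pt 1) (1 / 4) := by
  ext z
  have hsub : Metric.ball (D₀.pt 1) (1 / 4) ⊆ Metric.ball (D₀.pt 1) 1 :=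
    Metric.ball_subset_ball (by norm_num)
  have h := Set.ext_iff.1 D₀_flat z
  simp only [Set.mem_inter_iff, Set.mem_setOf_eq] at h ⊢
  constructor
  · rintro ⟨hD, hz⟩; exact ⟨(h.1 ⟨hD, hsub hz⟩).1, hz⟩
  · rintro ⟨him, hz⟩; exact ⟨(h.2 ⟨him, hsub hz⟩).1, hz⟩

/-- **The rows clause holds for `Λ₃`** in the ball of radius `1/4` about `b = 1 - i`: there the
family is the full half-plane piece `row ≥ m_δ` (the blob covers the quarter ball). -/
theorem rows_Λ₃ (hδ : 0 < δ) (hδ1 : δ ≤ 1 / 100) :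
    ∀ v : HexVertex, (δ : ℂ) * hexCenter v ∈ Metric.ball (D₀.pt 1) (1 / 4) →
      (v ∈ Λ₃ δ ↔ mRow δ ≤ v.1 1) := by
  intro v hv
  obtain ⟨h1, h2, h3, h4⟩ := ball_quarter hv
  change _ ↔ mRow δ ≤ row v
  constructor
  · intro h
    have := Λ₃_subset_ΛR hδ hδ1 h
    rw [← bv_row_pos v, bv_mem_ΛR] at this
    exact this.1
  · intro hm
    refine mem_Λ₃.2 (Or.inr (mem_Blob.2 ?_))
    rw [re_scaled] at h1 h2
    have i1 := im_scaled_ge δ hδ.le v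
    have hg := hgt_pos
    have hg1 := hgt_gt
    have hg2 := hgt_lt
    have hp : 0 < δ * hgt := by positivity
    have ht := t_ge hδ hδ1
    have hs := s_eq hδ
    have htm := t_mul hδ
    have hsm := s_mul hδ
    set t := 1 / (δ * hgt) with ht_def
    set s := 1 / δ with hs_def
    have e1 := lt_mRow δ
    have e2 := lt_iK' δ
    have a1 := X₁_le δ
    have a3 := le_X₂ δ
    simp only [← ht_def, ← hs_def] at e1 e2 a1 a3
    have hx := two_xz v
    have hmod : (pos v - row v) % 2 = 0 ∨ (pos v - row v) % 2 = 1 := by omega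
    -- real versions of the integer data
    have hm' : (mRow δ : ℝ) ≤ row v := by exact_mod_cast hm
    -- (a) the row is below the blob's top
    have hrow : (row v : ℝ) + 1 / 3 < -(3 / 4) * t := by
      have : δ * hgt * ((row v : ℝ) + 1 / 3) < -3 / 4 := lt_of_le_of_lt i1 h4
      have : δ * hgt * ((row v : ℝ) + 1 / 3) * t < -3 / 4 * t := by
        have htpos : 0 < t := by positivity
        nlinarith
      have e : δ * hgt * ((row v : ℝ) + 1 / 3) * t = (row v : ℝ) + 1 / 3 := by
        rw [show δ * hgt * ((row v : ℝ) + 1 / 3) * t = (δ * hgt * t) * ((row v : ℝ) + 1 / 3) by ring,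
          htm, one_mul]
      linarith
    have hrow' : (row v : ℝ) < mRow δ + iK δ + 1 := by nlinarith
    have hrowZ : row v ≤ mRow δ + iK δ + 1 := by
      have h' : (row v : ℝ) < ((mRow δ + iK δ + 1 : ℤ) : ℝ) := by push_cast; exact hrow'
      have h'' : row v < mRow δ + iK δ + 1 := by exact_mod_cast h'
      exact h''.le
    -- (b) the position window
    have hpos1 : (3 / 2 : ℝ) * s - 1 < (pos v : ℝ) + 1 + 0 := by
      have : 3 / 4 * s < δ * ((pos v : ℝ) + 1) / 2 * s := by
        have hspos : 0 < s := by positivity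
        nlinarith
      rw [show δ * ((pos v : ℝ) + 1) / 2 * s = (δ * s) * ((pos v : ℝ) + 1) / 2 by ring, hsm] at this
      linarith
    have hpos2 : (pos v : ℝ) + 1 < 5 / 2 * s := by
      have : δ * ((pos v : ℝ) + 1) / 2 * s < 5 / 4 * s := by
        have hspos : 0 < s := by positivity
        nlinarith
      rw [show δ * ((pos v : ℝ) + 1) / 2 * s = (δ * s) * ((pos v : ℝ) + 1) / 2 by ring, hsm] at this
      linarith
    have hxz1 : 2 * (X₁ δ : ℝ) + 2 ≤ 2 * xz v := by
      have : (2 * xz v : ℝ) ≥ pos v - row v - 1 := by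
        rcases hmod with h | h
        · have : (2 * xz v : ℤ) = pos v - row v := by omega
          have : ((2 * xz v : ℤ) : ℝ) = pos v - row v := by exact_mod_cast this
          push_cast at this; linarith
        · have : (2 * xz v : ℤ) = pos v - row v - 1 := by omega
          have : ((2 * xz v : ℤ) : ℝ) = pos v - row v - 1 := by exact_mod_cast this
          push_cast at this; linarith
      have hr' : (row v : ℝ) ≤ mRow δ + iK δ + 1 := by exact_mod_cast hrowZ
      nlinarith
    have hxz2 : (2 * xz v : ℝ) < 2 * X₂ δ := by
      have : (2 * xz v : ℝ) ≤ pos v - row v := by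
        have : (2 * xz v : ℤ) ≤ pos v - row v := by omega
        exact_mod_cast this
      nlinarith
    have k1 : X₁ δ ≤ xz v := by
      have : (2 * (X₁ δ : ℝ)) + 2 ≤ 2 * (xz v : ℝ) := by exact_mod_cast hxz1
      have : (X₁ δ : ℝ) ≤ xz v := by linarith
      exact_mod_cast this
    have k2 : xz v ≤ X₂ δ := by
      have : (xz v : ℝ) < X₂ δ := by
        have : (2 * (xz v : ℝ)) < 2 * X₂ δ := by exact_mod_cast hxz2
        linarith
      have : xz v < X₂ δ := by exact_mod_cast this
      omega
    exact ⟨k1, k2, hm, hrowZ⟩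

end Frame3


/-! #### Simple connectivity of `Λ₃`: the complement is connected -/

section SC3

variable {δ : ℝ}

/-- Coordinates of the members of `Λ₃` (staircase / run / blob). -/
theorem mem_Λ₃_coords (hδ : 0 < δ) (hδ1 : δ ≤ 1 / 100) {r p : ℤ} (h : bv r p ∈ Λ₃ δ) :
    (mRow δ ≤ r ∧ r ≤ mRow δ + iK δ + 1 ∧ (p = pA δ - (r - mRow δ) ∨ p = pA δ - (r - mRow δ) - 1)) ∨
    (r = rT δ ∧ pA δ - iK δ - 2 ≤ p ∧ p ≤ pE δ) ∨
    (X₁ δ ≤ (p - r - (p - r) % 2) / 2 ∧ (p - r - (p - r) % 2) / 2 ≤ X₂ δ ∧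
      mRow δ ≤ r ∧ r ≤ mRow δ + iK δ + 1) := by
  have hJ := J_eq hδ hδ1
  obtain ⟨-, -, -, -, -, -, hJ0⟩ := params₃ hδ hδ1
  rcases mem_Λ₃.1 h with ⟨i, hi, hci⟩ | hw
  · have hr := congrArg row hci
    have hp := congrArg pos hci
    rw [row_bv] at hr; rw [pos_bv] at hp
    unfold L₃ at hi
    rcases c₃_coords δ i with ⟨hi', r1, p1⟩ | ⟨hi', r1, p1⟩
    · rw [r1] at hr; rw [p1] at hp
      unfold I₀ rT pE at *
      rcases Nat.lt_or_ge i (2 * iK δ + 4) with hlt | hge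
      · left; omega
      · right; left; omega
    · rw [r1] at hr; rw [p1] at hp
      unfold I₀ rT pE at *
      right; left; omega
  · right; right; exact bv_mem_Blob.1 hw

theorem stair_mem_Λ₃ (hδ : 0 < δ) (hδ1 : δ ≤ 1 / 100) {r : ℤ} (h1 : mRow δ ≤ r) (h2 : r ≤ mRow δ + iK δ + 1) :
    bv r (pA δ - (r - mRow δ)) ∈ Λ₃ δ ∧ bv r (pA δ - (r - mRow δ) - 1) ∈ Λ₃ δ := by
  obtain ⟨-, -, -, -, -, -, hJ0⟩ := params₃ hδ hδ1
  obtain ⟨j, hj⟩ : ∃ j : ℕ, r = mRow δ + j := ⟨(r - mRow δ).toNat, by omega⟩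
  have hjK : j ≤ iK δ + 1 := by omega
  constructor
  · have e : c₃ δ (2 * j) = bv r (pA δ - (r - mRow δ)) := by
      rw [c₃_eq_stair (by unfold I₀; omega)]; unfold stair; congr 1 <;> omega
    exact e ▸ c₃_mem δ (by unfold L₃ I₀; omega)
  · have e : c₃ δ (2 * j + 1) = bv r (pA δ - (r - mRow δ) - 1) := by
      rw [c₃_eq_stair (by unfold I₀; omega)]; unfold stair; congr 1 <;> omega
    exact e ▸ c₃_mem δ (by unfold L₃ I₀; omega)

theorem run_mem_Λ₃ (hδ : 0 < δ) (hδ1 : δ ≤ 1 / 100) {p : ℤ} (h1 : pA δ - iK δ - 2 ≤ p) (h2 : p ≤ pE δ) :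
    bv (rT δ) p ∈ Λ₃ δ := by
  have hJ := J_eq hδ hδ1
  obtain ⟨n, hn⟩ : ∃ n : ℕ, p = pA δ - iK δ - 2 + n := ⟨(p - (pA δ - iK δ - 2)).toNat, by omega⟩
  have e : c₃ δ (I₀ δ + n) = bv (rT δ) p := by
    rcases c₃_coords δ (I₀ δ + n) with ⟨hi', r1, p1⟩ | ⟨hi', r1, p1⟩
    · have hn0 : n = 0 := by omega
      subst hn0
      rw [← bv_row_pos (c₃ δ (I₀ δ + 0)), r1, p1]; unfold rT I₀; congr 1 <;> omega
    · rw [← bv_row_pos (c₃ δ (I₀ δ + n)), r1, p1]; unfold rT; congr 1; omega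
  exact e ▸ c₃_mem δ (by unfold L₃; omega)

/-- Escape route: along row `r` from `p` to `q`, down the band `{q, q+1}` to row `m - 2`, then along
that (free) row to the anchor `(m - 2, pA)`. -/
theorem escape₃ {r p q : ℤ} (hr : mRow δ - 2 ≤ r)
    (hrun : ∀ t, min p q ≤ t → t ≤ max p q → bv r t ∉ Λ₃ δ)
    (hband : ∀ r', mRow δ - 2 ≤ r' → r' ≤ r → bv r' q ∉ Λ₃ δ ∧ bv r' (q + 1) ∉ Λ₃ δ) :
    Linked (↑(Λ₃ δ) : Set HexVertex)ᶜ (bv r p) (bv (mRow δ - 2) (pA δ)) := by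
  have nm : ∀ {v : HexVertex}, v ∉ Λ₃ δ → v ∈ (↑(Λ₃ δ) : Set HexVertex)ᶜ :=
    fun h => Set.mem_compl (fun h' => h (Finset.mem_coe.1 h'))
  -- along row `r`
  have h1 : Linked (↑(Λ₃ δ) : Set HexVertex)ᶜ (bv r p) (bv r q) := by
    rcases le_total p q with hpq | hpq
    · exact linked_run' r p q hpq fun t ht1 ht2 => nm (hrun t (by omega) (by omega))
    · exact (linked_run' r q p hpq fun t ht1 ht2 => nm (hrun t (by omega) (by omega))).symm
  -- down the band
  have h2 : Linked (↑(Λ₃ δ) : Set HexVertex)ᶜ (bv r q) (bv (mRow δ - 2) q) :=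
    linked_band q (mRow δ - 2) r hr fun r' h1' h2' => ⟨nm (hband r' h1' h2').1, nm (hband r' h1' h2').2⟩
  -- along the free row `m - 2`
  have h3 : Linked (↑(Λ₃ δ) : Set HexVertex)ᶜ (bv (mRow δ - 2) q) (bv (mRow δ - 2) (pA δ)) := by
    rcases le_total q (pA δ) with hq | hq
    · exact linked_run' _ q (pA δ) hq fun t _ _ => nm (bv_not_mem_Λ₃_of_row_lt (by omega))
    · exact (linked_run' _ (pA δ) q hq fun t _ _ => nm (bv_not_mem_Λ₃_of_row_lt (by omega))).symm
  exact (h1.trans h2).trans h3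

/-- Every vertex off `Λ₃` is linked, off `Λ₃`, to the anchor `(m - 2, pA)`. -/
theorem linked_compl_Λ₃ (hδ : 0 < δ) (hδ1 : δ ≤ 1 / 100) {v : HexVertex} (hv : v ∉ Λ₃ δ) :
    Linked (↑(Λ₃ δ) : Set HexVertex)ᶜ v (bv (mRow δ - 2) (pA δ)) := by
  obtain ⟨hiM, hM0, hm10, hPa, hpa, hpb, hbP, hP100, -⟩ := params hδ hδ1
  obtain ⟨h12, hfar, hPP, hb1, hb2, hJ2, hJ0⟩ := params₃ hδ hδ1
  have hJ := J_eq hδ hδ1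
  have hmod := pA_mod δ
  have nm : ∀ {v : HexVertex}, v ∉ Λ₃ δ → v ∈ (↑(Λ₃ δ) : Set HexVertex)ᶜ :=
    fun h => Set.mem_compl (fun h' => h (Finset.mem_coe.1 h'))
  -- a coordinate test for non-membership
  have test : ∀ r p : ℤ,
      ¬ (mRow δ ≤ r ∧ r ≤ mRow δ + iK δ + 1 ∧ (p = pA δ - (r - mRow δ) ∨ p = pA δ - (r - mRow δ) - 1)) →
      ¬ (r = rT δ ∧ pA δ - iK δ - 2 ≤ p ∧ p ≤ pE δ) →
      ¬ (X₁ δ ≤ (p - r - (p - r) % 2) / 2 ∧ (p - r - (p - r) % 2) / 2 ≤ X₂ δ ∧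
          mRow δ ≤ r ∧ r ≤ mRow δ + iK δ + 1) →
      bv r p ∉ Λ₃ δ := by
    intro r p h1 h2 h3 h
    rcases mem_Λ₃_coords hδ hδ1 h with h' | h' | h'
    · exact h1 h'
    · exact h2 h'
    · exact h3 h'
  rw [← bv_row_pos v] at hv ⊢
  set r := row v with hr
  set p := pos v with hp
  unfold rT pE at *
  -- R0b: far below
  by_cases hR0b : r < mRow δ - 2
  · have h1 : Linked (↑(Λ₃ δ) : Set HexVertex)ᶜ (bv (mRow δ - 2) p) (bv r p) :=
      linked_band p r (mRow δ - 2) (by omega) fun r' _ h2' =>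
        ⟨nm (bv_not_mem_Λ₃_of_row_lt (by omega)), nm (bv_not_mem_Λ₃_of_row_lt (by omega))⟩
    refine h1.symm.trans ?_
    rcases le_total p (pA δ) with hq | hq
    · exact linked_run' _ p (pA δ) hq fun t _ _ => nm (bv_not_mem_Λ₃_of_row_lt (by omega))
    · exact (linked_run' _ (pA δ) p hq fun t _ _ => nm (bv_not_mem_Λ₃_of_row_lt (by omega))).symm
  -- R0a: just below the bottom row
  by_cases hR0a : r ≤ mRow δ - 1
  · exact escape₃ (q := p) (by omega)
      (fun t _ _ => bv_not_mem_Λ₃_of_row_lt (by omega))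
      (fun r' _ h2' => ⟨bv_not_mem_Λ₃_of_row_lt (by omega), bv_not_mem_Λ₃_of_row_lt (by omega)⟩)
  -- R1: above the corridor's top row
  by_cases hR1 : mRow δ + iK δ + 3 ≤ r
  · refine escape₃ (q := pA δ - iK δ - 6) (by omega) ?_ ?_
    · intro t _ _; exact test r t (by omega) (by omega) (by omega)
    · intro r' _ _
      exact ⟨test r' _ (by omega) (by omega) (by omega), test r' _ (by omega) (by omega) (by omega)⟩
  -- now `mRow ≤ r ≤ rT`
  -- R2: left of the corridor
  by_cases hR2 : (r < mRow δ + iK δ + 2 ∧ p ≤ pA δ - (r - mRow δ) - 2) ∨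
      (r = mRow δ + iK δ + 2 ∧ p ≤ pA δ - iK δ - 3)
  · refine escape₃ (q := pA δ - iK δ - 6) (by omega) ?_ ?_
    · intro t ht1 ht2; exact test r t (by omega) (by omega) (by omega)
    · intro r' _ _
      exact ⟨test r' _ (by omega) (by omega) (by omega), test r' _ (by omega) (by omega) (by omega)⟩
  -- R5: top row, right of the run
  by_cases hR5 : r = mRow δ + iK δ + 2
  · have hpE : 2 * X₁ δ + mRow δ + iK δ + 2 + 1 ≤ p := by
      by_contra hcon
      exact hv (hR5 ▸ run_mem_Λ₃ hδ hδ1 (by omega) (by unfold pE; omega))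
    refine escape₃ (q := 2 * X₂ δ + (mRow δ + iK δ + 2) + 2) (by omega) ?_ ?_
    · intro t ht1 _; exact test r t (by omega) (by omega) (by omega)
    · intro r' _ _
      exact ⟨test r' _ (by omega) (by omega) (by omega), test r' _ (by omega) (by omega) (by omega)⟩
  -- rows `mRow ≤ r ≤ rT - 1`, right of the staircase
  have hrr : mRow δ ≤ r ∧ r ≤ mRow δ + iK δ + 1 := by omega
  have hst := stair_mem_Λ₃ hδ hδ1 hrr.1 hrr.2
  have hpst : pA δ - (r - mRow δ) + 1 ≤ p := by
    by_contra hcon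
    have : p = pA δ - (r - mRow δ) ∨ p = pA δ - (r - mRow δ) - 1 := by omega
    rcases this with h | h
    · exact hv (h ▸ hst.1)
    · exact hv (h ▸ hst.2)
  have hx := two_xz (bv r p)
  rw [row_bv, pos_bv] at hx
  by_cases hR3 : (p - r - (p - r) % 2) / 2 < X₁ δ
  · -- R3: left of the blob: along the row to column `pA + 2`, then down
    refine escape₃ (q := pA δ + 2) (by omega) ?_ ?_
    · intro t ht1 ht2; exact test r t (by omega) (by omega) (by omega)
    · intro r' _ _
      exact ⟨test r' _ (by omega) (by omega) (by omega), test r' _ (by omega) (by omega) (by omega)⟩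
  by_cases hR4 : X₂ δ < (p - r - (p - r) % 2) / 2
  · -- R4: right of the blob: straight down
    refine escape₃ (q := p) (by omega) ?_ ?_
    · intro t ht1 ht2; exact test r t (by omega) (by omega) (by omega)
    · intro r' _ _
      exact ⟨test r' _ (by omega) (by omega) (by omega), test r' _ (by omega) (by omega) (by omega)⟩
  -- otherwise the vertex is in the blob
  exfalso
  exact hv (mem_Λ₃.2 (Or.inr (bv_mem_Blob.2 ⟨by omega, by omega, hrr.1, hrr.2⟩)))

theorem simplyConnected_Λ₃ (hδ : 0 < δ) (hδ1 : δ ≤ 1 / 100) : hexDomainSimplyConnected (Λ₃ δ) :=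
  preconnected_of_linked fun _ hu _ hv =>
    (linked_compl_Λ₃ hδ hδ1 (fun h => hu (Finset.mem_coe.2 h))).trans
      (linked_compl_Λ₃ hδ hδ1 (fun h => hv (Finset.mem_coe.2 h))).symm

end SC3


/-! ### K.6 Exhaustion is load-bearing: the crux and stub 2 are FALSE without it -/

/-- **Endgame, general exponent.** An eventual inequality `δ² x^ℓ ≤ C δ^{-s} x^{ℓ+N}` with `s ≤ 1`,
`N ≥ 4n`, `n ≥ 1/(6δ)` is impossible. -/
theorem endgame' {x : ℝ} (hx0 : 0 < x) (hx1 : x ≤ 3 / 5) {s : ℝ} (hs : s ≤ 1) (C : ℝ) (ℓ N n : ℝ → ℕ)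
    (hev : ∀ᶠ δ in nhdsWithin 0 (Set.Ioi 0),
      δ ^ 2 * x ^ (ℓ δ) ≤ C * δ ^ (-s) * x ^ (ℓ δ + N δ))
    (hN : ∀ᶠ δ in nhdsWithin 0 (Set.Ioi 0), 4 * n δ ≤ N δ ∧ 1 / (6 * δ) ≤ (n δ : ℝ)) : False := by
  set ε₀ : ℝ := min 1 (1 / (6561 * |C| + 1)) with hε₀
  have hε₀pos : 0 < ε₀ := lt_min one_pos (by positivity)
  have hsmall : ∀ᶠ δ in nhdsWithin 0 (Set.Ioi 0), 0 < δ ∧ δ < ε₀ := by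
    filter_upwards [Ioo_mem_nhdsGT hε₀pos] with δ hδ using ⟨hδ.1, hδ.2⟩
  obtain ⟨δ, ⟨hδ0, hδε⟩, hineq, hNn, hn⟩ := (hsmall.and (hev.and hN)).exists
  have hδ1 : δ ≤ 1 := le_trans hδε.le (min_le_left _ _)
  have hx1' : x ≤ 1 := by linarith
  have hL : 0 < δ ^ 2 * x ^ (ℓ δ) := by positivity
  have hrpow_pos : 0 < δ ^ (-s) := Real.rpow_pos_of_pos hδ0 _
  by_cases hC' : C < 0
  · have : C * δ ^ (-s) * x ^ (ℓ δ + N δ) < 0 := by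
      have h1 : C * δ ^ (-s) < 0 := mul_neg_of_neg_of_pos hC' hrpow_pos
      exact mul_neg_of_neg_of_pos h1 (by positivity)
    linarith
  have hC : 0 ≤ C := not_lt.1 hC'
  have hrpow : δ ^ (-s) ≤ δ⁻¹ := by
    rw [← Real.rpow_neg_one]
    exact Real.rpow_le_rpow_of_exponent_ge hδ0 hδ1 (by linarith)
  have hn1 : 1 ≤ n δ := by
    have : (0:ℝ) < n δ := lt_of_lt_of_le (by positivity) hn
    exact_mod_cast this
  have hxn : x ^ (n δ) ≤ 9 * δ := by
    have h := pow_le_of_bernoulli hx0 hx1 (n δ) hn1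
    have hnpos : (0:ℝ) < n δ := by exact_mod_cast hn1
    calc x ^ (n δ) ≤ 3 / (2 * n δ) := h
      _ ≤ 3 / (2 * (1 / (6 * δ))) := by
        apply div_le_div_of_nonneg_left (by norm_num) (by positivity)
        nlinarith
      _ = 9 * δ := by field_simp; ring
  have hxN : x ^ (N δ) ≤ (9 * δ) ^ 4 := by
    calc x ^ (N δ) ≤ x ^ (4 * n δ) := pow_le_pow_of_le_one hx0.le hx1' hNn
      _ = (x ^ (n δ)) ^ 4 := by rw [pow_mul']
      _ ≤ (9 * δ) ^ 4 := pow_le_pow_left₀ (by positivity) hxn 4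
  have key : δ ^ 2 * x ^ (ℓ δ) ≤ C * δ⁻¹ * (x ^ (ℓ δ) * (9 * δ) ^ 4) := by
    calc δ ^ 2 * x ^ (ℓ δ) ≤ C * δ ^ (-s) * x ^ (ℓ δ + N δ) := hineq
      _ = C * δ ^ (-s) * (x ^ (ℓ δ) * x ^ (N δ)) := by rw [pow_add]
      _ ≤ C * δ⁻¹ * (x ^ (ℓ δ) * (9 * δ) ^ 4) := by
        apply mul_le_mul (mul_le_mul_of_nonneg_left hrpow hC) _ (by positivity) (by positivity)
        exact mul_le_mul_of_nonneg_left hxN (by positivity)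
  have hxl : 0 < x ^ (ℓ δ) := by positivity
  have key2 : δ ^ 2 ≤ C * δ⁻¹ * (9 * δ) ^ 4 := by
    have key' : δ ^ 2 * x ^ (ℓ δ) ≤ C * δ⁻¹ * (9 * δ) ^ 4 * x ^ (ℓ δ) := by
      calc δ ^ 2 * x ^ (ℓ δ) ≤ C * δ⁻¹ * (x ^ (ℓ δ) * (9 * δ) ^ 4) := key
        _ = C * δ⁻¹ * (9 * δ) ^ 4 * x ^ (ℓ δ) := by ring
    exact le_of_mul_le_mul_right key' hxl
  have key3 : 1 ≤ 6561 * C * δ := by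
    have h9 : C * δ⁻¹ * (9 * δ) ^ 4 = 6561 * C * δ * δ ^ 2 := by field_simp; ring
    rw [h9] at key2
    have hδ2 : 0 < δ ^ 2 := by positivity
    by_contra hcon
    have hcon' : 6561 * C * δ < 1 := not_le.1 hcon
    nlinarith
  have hδs : δ < 1 / (6561 * |C| + 1) := lt_of_lt_of_le hδε (min_le_right _ _)
  rw [abs_of_nonneg hC] at hδs
  rw [lt_div_iff₀ (by positivity)] at hδs
  nlinarith

section Violation3

variable {δ : ℝ}

/-- **Starvation of `b_δ` through the corridor**: for every spin, `|F_{x_c,τ}(b_δ)| ≤ x_c^{L₃+1}`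
(corridor transfer `× Z_Blob ≤ 1`). -/
theorem norm_F_bE_le (hδ : 0 < δ) (hδ1 : δ ≤ 1 / 100) (τ : ℝ) :
    ‖hexParafermionicObservable (Λ₃ δ) (aE δ) hexCriticalFugacity τ (bE δ)‖ ≤
      hexCriticalFugacity ^ (L₃ δ + 1) := by
  obtain ⟨hiM, hM0, hm10, hPa, hpa, hpb, hbP, hP100, -⟩ := params hδ hδ1
  have hx0 : (0:ℝ) ≤ hexCriticalFugacity := hexCriticalFugacity_pos_lt_one.1.le
  have hz : ∀ i, i ≤ L₃ δ → c₃ δ i ∉ bE δ := by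
    intro i hi h
    have h' : c₃ δ i = bv (mRow δ) (pB δ) ∨ c₃ δ i = bv (mRow δ - 1) (pB δ) := Sym2.mem_iff.1 h
    rcases h' with h' | h' <;>
    · have hr := congrArg row h'
      have hp := congrArg pos h'
      rw [row_bv] at hr; rw [pos_bv] at hp
      rcases c₃_coords δ i with ⟨-, r1, p1⟩ | ⟨-, r1, p1⟩ <;>
      · rw [r1] at hr; rw [p1] at hp; unfold I₀ at *; omega
  rw [aE_eq₃]
  calc ‖hexParafermionicObservable (Λ₃ δ) s(bv (mRow δ - 1) (pA δ), c₃ δ 0) hexCriticalFugacity τ (bE δ)‖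
      ≤ hexCriticalFugacity ^ (L₃ δ + 1) *
          ‖hexParafermionicObservable (Blob δ) s(c₃ δ (L₃ δ), Xv δ) hexCriticalFugacity 0 (bE δ)‖ :=
        norm_F_le_corridor_blob (bv_not_mem_Λ₃_of_row_lt (by omega)) (bare₃ hδ hδ1) hz
          ⟨bv (mRow δ - 1) (pB δ), Sym2.mem_mk_right _ _, bv_not_mem_Λ₃_of_row_lt (by omega)⟩
          (fun w hw => mem_Λ₃.1 hw) (Xv_mem_Blob hδ hδ1) (adj_c₃_Xv hδ hδ1) hx0 τ
    _ ≤ hexCriticalFugacity ^ (L₃ δ + 1) * 1 :=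
        mul_le_mul_of_nonneg_left (norm_Z_blob_le_one hδ hδ1) (pow_nonneg hx0 _)
    _ = hexCriticalFugacity ^ (L₃ δ + 1) := mul_one _

/-- **The `K`-edge keeps its mass, at every spin**: `|F_{x_c,σ}(e₀)| = x_c^{2 iK + 1}` exactly. -/
theorem norm_F_e₀_eq (hδ : 0 < δ) (hδ1 : δ ≤ 1 / 100) (σ : ℝ) :
    ‖hexParafermionicObservable (Λ₃ δ) (aE δ) hexCriticalFugacity σ (e₀ δ)‖ =
      hexCriticalFugacity ^ (2 * iK δ + 1) := by
  obtain ⟨hiM, hM0, hm10, hPa, hpa, hpb, hbP, hP100, -⟩ := params hδ hδ1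
  obtain ⟨-, -, -, -, -, hJ2, -⟩ := params₃ hδ hδ1
  have hJ := J_eq hδ hδ1
  have hx0 : (0:ℝ) ≤ hexCriticalFugacity := hexCriticalFugacity_pos_lt_one.1.le
  have he : e₀ δ = s(c₃ δ (2 * iK δ), c₃ δ (2 * iK δ + 1)) := by
    rw [e₀, c₃_eq_stair (by unfold I₀; omega), c₃_eq_stair (by unfold I₀; omega)]
  rw [aE_eq₃, he]
  exact norm_F_corridor_edge (L := L₃ δ) (X := Xv δ) (bv_not_mem_Λ₃_of_row_lt (by omega))
    (fun i hi => c₃_mem δ hi) (fun i j _ _ h => c₃_inj δ h) (fun i _ => adj_c₃ δ i)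
    (by rw [c₃_zero]; exact adj_aE δ) (bare₃ hδ hδ1) (by unfold L₃ I₀; omega) hx0 σ

/-- **THE CORE COMPARISON (corridor-fed blob family).** For `K = Kbox`, no constant `C` and no
exponent `s ≤ 1` bound the `K`-averaged bulk mass of `F_{x_c,σ}` by `C δ^{-s}` times `|F_{x_c,τ}(b_δ)|`:
the corridor edge `e₀ ∈ K` keeps mass `x_c^{2 iK + 1}` while `b_δ`, behind `≈ 3.9/δ` further corridor
steps, is starved to `≤ x_c^{L₃ + 1}`. (Any spins `σ`, `τ`: there is no cancellation on a bare corridor.) -/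
theorem Λ₃_violates (C s σ τ : ℝ) (hs : s ≤ 1) :
    ¬ (∀ᶠ δ : ℝ in nhdsWithin 0 (Set.Ioi 0),
      δ ^ 2 * (∑ᶠ e ∈ {e : Sym2 HexVertex | e ∈ hexDomainMidEdges (Λ₃ δ) ∧
        (δ : ℂ) * hexMidpoint e ∈ Kbox},
        ‖hexParafermionicObservable (Λ₃ δ) (aE δ) hexCriticalFugacity σ e‖) ≤
      C * δ ^ (-s) * ‖hexParafermionicObservable (Λ₃ δ) (aE δ) hexCriticalFugacity τ (bE δ)‖) := by
  intro hev
  have hx0 := hexCriticalFugacity_pos_lt_one.1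
  -- the left-hand side dominates `δ² x^{2 iK + 1}`, the right-hand side is `≤ C δ^{-s} x^{L₃+1}`
  have hcore : ∀ᶠ δ : ℝ in nhdsWithin 0 (Set.Ioi 0), 0 < δ ∧
      δ ^ 2 * hexCriticalFugacity ^ (2 * iK δ + 1) ≤
        C * δ ^ (-s) * ‖hexParafermionicObservable (Λ₃ δ) (aE δ) hexCriticalFugacity τ (bE δ)‖ ∧
      ‖hexParafermionicObservable (Λ₃ δ) (aE δ) hexCriticalFugacity τ (bE δ)‖ ≤
        hexCriticalFugacity ^ (2 * iK δ + 1 + (L₃ δ - 2 * iK δ)) ∧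
      (4 * (iK δ / 2) ≤ L₃ δ - 2 * iK δ ∧ 1 / (6 * δ) ≤ ((iK δ / 2 : ℕ) : ℝ)) := by
    filter_upwards [hev, Ioo_mem_nhdsGT (show (0:ℝ) < 1 / 100 by norm_num)] with δ hδ hδ'
    have hδ0 := hδ'.1
    have hδ1 : δ ≤ 1 / 100 := hδ'.2.le
    obtain ⟨-, -, -, -, hpa, hpb, -, -, -, -, hn⟩ := params hδ0 hδ1
    obtain ⟨-, -, -, -, -, hJ2, -⟩ := params₃ hδ0 hδ1
    have hJ := J_eq hδ0 hδ1
    have hE : ({e : Sym2 HexVertex | e ∈ hexDomainMidEdges (Λ₃ δ) ∧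
        (δ : ℂ) * hexMidpoint e ∈ Kbox}).Finite :=
      (hexDomainMidEdges_finite (Λ₃ δ)).subset fun e he => he.1
    have hstair : stair δ (2 * iK δ) ∈ Λ₃ δ := by
      rw [← c₃_eq_stair (by unfold I₀; omega)]; exact c₃_mem δ (by unfold L₃ I₀; omega)
    have hterm := term_le_finsum_mem hE (f := fun e =>
      ‖hexParafermionicObservable (Λ₃ δ) (aE δ) hexCriticalFugacity σ e‖) (fun e => norm_nonneg _)
      ⟨e₀_mem_of hstair, e₀_mem_Kbox hδ0 hδ1⟩
    rw [norm_F_e₀_eq hδ0 hδ1 σ] at hterm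
    refine ⟨hδ0, (mul_le_mul_of_nonneg_left hterm (by positivity)).trans hδ, ?_, ?_⟩
    · have hexp : 2 * iK δ + 1 + (L₃ δ - 2 * iK δ) = L₃ δ + 1 := by unfold L₃ I₀; omega
      rw [hexp]; exact norm_F_bE_le hδ0 hδ1 τ
    · refine ⟨by unfold L₃ I₀; omega, hn⟩
  by_cases hC : C < 0
  · obtain ⟨δ, hδ0, hineq, -, -⟩ := hcore.exists
    have hL : 0 < δ ^ 2 * hexCriticalFugacity ^ (2 * iK δ + 1) := by positivity
    have hR : C * δ ^ (-s) * ‖hexParafermionicObservable (Λ₃ δ) (aE δ) hexCriticalFugacity τ (bE δ)‖ ≤ 0 :=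
      mul_nonpos_of_nonpos_of_nonneg
        (mul_nonpos_of_nonpos_of_nonneg hC.le (Real.rpow_pos_of_pos hδ0 _).le) (norm_nonneg _)
    linarith
  have hC' : 0 ≤ C := not_lt.1 hC
  refine endgame' hx0 xc_lt.le hs C (fun δ => 2 * iK δ + 1) (fun δ => L₃ δ - 2 * iK δ)
    (fun δ => iK δ / 2) ?_ ?_
  · filter_upwards [hcore] with δ hδ
    obtain ⟨hδ0, h1, h2, -⟩ := hδ
    exact h1.trans (mul_le_mul_of_nonneg_left h2
      (mul_nonneg hC' (Real.rpow_pos_of_pos hδ0 _).le))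
  · filter_upwards [hcore] with δ hδ
    exact hδ.2.2.2

/-- `MassRatio` with the EXHAUSTION hypothesis DELETED, everything else verbatim. -/
def MassRatioWithoutExhaustion : Prop :=
  ∀ (D : Literature.Probability.RandomPlanarGeometry.DobrushinDomain) (ρ : ℝ)
    (Λ : ℝ → Finset HexVertex) (m : ℝ → ℤ) (a b : ℝ → Sym2 HexVertex),
  let Z : ℝ → Sym2 HexVertex → ℂ := fun δ z =>
    hexParafermionicObservable (Λ δ) (a δ) hexCriticalFugacity 0 z;
  0 < ρ → D.carrier ∩ Metric.ball (D.pt 1) ρ = {z : ℂ | (D.pt 1).im < z.im} ∩ Metric.ball (D.pt 1) ρ →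
  (∀ᶠ δ : ℝ in nhdsWithin 0 (Set.Ioi 0), hexDomainSimplyConnected (Λ δ) ∧
    a δ ∈ hexDomainBoundary (Λ δ) ∧ b δ ∈ hexDomainBoundary (Λ δ) ∧
    Nonempty (HexMidEdgeSAW (Λ δ) (a δ) (b δ)) ∧
    (hexGraph.induce ((Λ δ : Finset HexVertex) : Set HexVertex)).Preconnected ∧
    (∀ v ∈ Λ δ, (δ : ℂ) * hexCenter v ∈ D.carrier) ∧
    (∀ v : HexVertex, (δ : ℂ) * hexCenter v ∈ Metric.ball (D.pt 1) ρ → (v ∈ Λ δ ↔ m δ ≤ v.1 1))) →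
  Filter.Tendsto (fun δ : ℝ => (δ : ℂ) * hexMidpoint (a δ)) (nhdsWithin 0 (Set.Ioi 0)) (nhds (D.pt 0)) →
  Filter.Tendsto (fun δ : ℝ => (δ : ℂ) * hexMidpoint (b δ)) (nhdsWithin 0 (Set.Ioi 0)) (nhds (D.pt 1)) →
  ∀ K : Set ℂ, IsCompact K → K ⊆ D.carrier → ∃ C : ℝ, ∀ᶠ δ : ℝ in nhdsWithin 0 (Set.Ioi 0),
    δ ^ 2 * (∑ᶠ e ∈ {e : Sym2 HexVertex | e ∈ hexDomainMidEdges (Λ δ) ∧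
      (δ : ℂ) * hexMidpoint e ∈ K}, ‖Z δ e‖) ≤ C * δ ^ (-(3 : ℝ) / 4) * ‖Z δ (b δ)‖

/-- Stub 2 of the line (`stub_localL1BoundZ`, reshape 2: `L¹` bound of `F_{x_c,5/8}` on `K`
normalised by the boundary MASS `Z_δ(b_δ)`), with the EXHAUSTION hypothesis DELETED. -/
def LocalL1BoundZWithoutExhaustion (s : ℝ) : Prop :=
  ∀ (D : Literature.Probability.RandomPlanarGeometry.DobrushinDomain) (ρ : ℝ)
    (Λ : ℝ → Finset HexVertex) (m : ℝ → ℤ) (a b : ℝ → Sym2 HexVertex),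
  0 < ρ → D.carrier ∩ Metric.ball (D.pt 1) ρ = {z : ℂ | (D.pt 1).im < z.im} ∩ Metric.ball (D.pt 1) ρ →
  (∀ᶠ δ : ℝ in nhdsWithin 0 (Set.Ioi 0), hexDomainSimplyConnected (Λ δ) ∧
    a δ ∈ hexDomainBoundary (Λ δ) ∧ b δ ∈ hexDomainBoundary (Λ δ) ∧
    Nonempty (HexMidEdgeSAW (Λ δ) (a δ) (b δ)) ∧
    (hexGraph.induce ((Λ δ : Finset HexVertex) : Set HexVertex)).Preconnected ∧
    (∀ v ∈ Λ δ, (δ : ℂ) * hexCenter v ∈ D.carrier) ∧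
    (∀ v : HexVertex, (δ : ℂ) * hexCenter v ∈ Metric.ball (D.pt 1) ρ → (v ∈ Λ δ ↔ m δ ≤ v.1 1))) →
  Filter.Tendsto (fun δ : ℝ => (δ : ℂ) * hexMidpoint (a δ)) (nhdsWithin 0 (Set.Ioi 0)) (nhds (D.pt 0)) →
  Filter.Tendsto (fun δ : ℝ => (δ : ℂ) * hexMidpoint (b δ)) (nhdsWithin 0 (Set.Ioi 0)) (nhds (D.pt 1)) →
  ∀ K : Set ℂ, IsCompact K → K ⊆ D.carrier → ∃ C : ℝ, ∀ᶠ δ : ℝ in nhdsWithin 0 (Set.Ioi 0),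
    δ ^ 2 * (∑ᶠ e ∈ {e : Sym2 HexVertex | e ∈ hexDomainMidEdges (Λ δ) ∧
      (δ : ℂ) * hexMidpoint e ∈ K}, ‖hexParafermionicObservable (Λ δ) (a δ) hexCriticalFugacity (5 / 8) e‖) ≤
      C * δ ^ (-s) * ‖hexParafermionicObservable (Λ δ) (a δ) hexCriticalFugacity 0 (b δ)‖

/-- The round-1 stub 2 (`stub_localL1Bound`, normalised by `|F_{x_c,5/8}(b_δ)|`) with the EXHAUSTION
hypothesis DELETED. -/
def LocalL1BoundWithoutExhaustion (s : ℝ) : Prop :=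
  ∀ (D : Literature.Probability.RandomPlanarGeometry.DobrushinDomain) (ρ : ℝ)
    (Λ : ℝ → Finset HexVertex) (m : ℝ → ℤ) (a b : ℝ → Sym2 HexVertex),
  0 < ρ → D.carrier ∩ Metric.ball (D.pt 1) ρ = {z : ℂ | (D.pt 1).im < z.im} ∩ Metric.ball (D.pt 1) ρ →
  (∀ᶠ δ : ℝ in nhdsWithin 0 (Set.Ioi 0), hexDomainSimplyConnected (Λ δ) ∧
    a δ ∈ hexDomainBoundary (Λ δ) ∧ b δ ∈ hexDomainBoundary (Λ δ) ∧
    Nonempty (HexMidEdgeSAW (Λ δ) (a δ) (b δ)) ∧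
    (hexGraph.induce ((Λ δ : Finset HexVertex) : Set HexVertex)).Preconnected ∧
    (∀ v ∈ Λ δ, (δ : ℂ) * hexCenter v ∈ D.carrier) ∧
    (∀ v : HexVertex, (δ : ℂ) * hexCenter v ∈ Metric.ball (D.pt 1) ρ → (v ∈ Λ δ ↔ m δ ≤ v.1 1))) →
  Filter.Tendsto (fun δ : ℝ => (δ : ℂ) * hexMidpoint (a δ)) (nhdsWithin 0 (Set.Ioi 0)) (nhds (D.pt 0)) →
  Filter.Tendsto (fun δ : ℝ => (δ : ℂ) * hexMidpoint (b δ)) (nhdsWithin 0 (Set.Ioi 0)) (nhds (D.pt 1)) →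
  ∀ K : Set ℂ, IsCompact K → K ⊆ D.carrier → ∃ C : ℝ, ∀ᶠ δ : ℝ in nhdsWithin 0 (Set.Ioi 0),
    δ ^ 2 * (∑ᶠ e ∈ {e : Sym2 HexVertex | e ∈ hexDomainMidEdges (Λ δ) ∧
      (δ : ℂ) * hexMidpoint e ∈ K}, ‖hexParafermionicObservable (Λ δ) (a δ) hexCriticalFugacity (5 / 8) e‖) ≤
      C * δ ^ (-s) * ‖hexParafermionicObservable (Λ δ) (a δ) hexCriticalFugacity (5 / 8) (b δ)‖

/-- the frame of the corridor-fed blob family (everything but exhaustion; rows clause at radius 1/4) -/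
theorem frame_Λ₃ : ∀ᶠ δ : ℝ in nhdsWithin 0 (Set.Ioi 0), hexDomainSimplyConnected (Λ₃ δ) ∧
    aE δ ∈ hexDomainBoundary (Λ₃ δ) ∧ bE δ ∈ hexDomainBoundary (Λ₃ δ) ∧
    Nonempty (HexMidEdgeSAW (Λ₃ δ) (aE δ) (bE δ)) ∧
    (hexGraph.induce ((Λ₃ δ : Finset HexVertex) : Set HexVertex)).Preconnected ∧
    (∀ v ∈ Λ₃ δ, (δ : ℂ) * hexCenter v ∈ D₀.carrier) ∧
    (∀ v : HexVertex, (δ : ℂ) * hexCenter v ∈ Metric.ball (D₀.pt 1) (1 / 4) →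
      (v ∈ Λ₃ δ ↔ mRow δ ≤ v.1 1)) := by
  filter_upwards [Ioo_mem_nhdsGT (show (0:ℝ) < 1 / 100 by norm_num)] with δ hδ
  obtain ⟨hδ0, hδ1⟩ := hδ
  exact ⟨simplyConnected_Λ₃ hδ0 hδ1.le, aE_mem_boundary₃ δ, bE_mem_boundary₃ hδ0 hδ1.le,
    nonempty_saw_Λ₃ hδ0 hδ1.le, preconnected_Λ₃ hδ0 hδ1.le, inside_Λ₃ hδ0 hδ1.le, rows_Λ₃ hδ0 hδ1.le⟩

/-- **Exhaustion is load-bearing for the crux: `MassRatio` with the exhaustion hypothesis deleted is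
FALSE.** Witness: `D₀ = (-2,2)×(-1,1)` marked at `-1-i`, `1-i`; `ρ = 1/4`; the family `Λ₃` = bare
corridor (staircase into `Kbox`, run along row `m + iK + 2`) feeding the blob (the lattice
parallelogram `X₁ ≤ x₀ ≤ X₂`, rows `m … m+iK+1`, which contains the quarter-ball about `b`, so the rows
clause holds); `a_δ = aE δ → -1-i`, `b_δ = bE δ → 1-i`, `K = Kbox`. Mechanism: upstream corridor
edges in `K` keep mass `x_c^{O(1/δ)}` while everything past the corridor — in particular `b_δ` — is
starved by a further factor `x_c^{≈ 3.9/δ}`; the blob only contributes `Z_Blob(entry → b_δ) ≤ B_{T,L}(x_c)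
≤ 1` (Duminil-Copin–Smirnov Lemma 2, through the chart `Φ₃`). Any proof of the crux must use exhaustion:
it is what forces the bulk around `K` to be present and `b_δ` to be reachable from `K` through bulk. -/
theorem massRatio_false_without_exhaustion : ¬ MassRatioWithoutExhaustion := by
  intro h
  obtain ⟨C, hC⟩ := h D₀ (1 / 4) Λ₃ mRow aE bE (by norm_num) D₀_flat_quarter frame_Λ₃
    tendsto_aE tendsto_bE Kbox Kbox_compact Kbox_sub
  refine Λ₃_violates C (3 / 4) 0 0 (by norm_num) ?_
  filter_upwards [hC] with δ hδ
  rw [show -((3 : ℝ) / 4) = -(3 : ℝ) / 4 by ring]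
  exact hδ

/-- **Exhaustion is load-bearing for stub 2 (`stub_localL1BoundZ`)**: with the exhaustion hypothesis
deleted, the `Z_δ(b_δ)`-normalised local `L¹` bound of `F_{x_c,5/8}` fails for EVERY exponent `s ≤ 1`
(same witness; `|F_{x_c,5/8}(e₀)| = x_c^{2iK+1}` exactly on the corridor — no phase can help). -/
theorem localL1BoundZ_false_without_exhaustion {s : ℝ} (hs : s ≤ 1) :
    ¬ LocalL1BoundZWithoutExhaustion s := by
  intro h
  obtain ⟨C, hC⟩ := h D₀ (1 / 4) Λ₃ mRow aE bE (by norm_num) D₀_flat_quarter frame_Λ₃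
    tendsto_aE tendsto_bE Kbox Kbox_compact Kbox_sub
  exact Λ₃_violates C s (5 / 8) 0 hs hC

/-- The `∀ s > 0` form of stub 2 without exhaustion is false (take `s = 1/2`). -/
theorem localL1BoundZ_false_without_exhaustion' :
    ¬ (∀ s : ℝ, 0 < s → LocalL1BoundZWithoutExhaustion s) := fun h =>
  localL1BoundZ_false_without_exhaustion (s := 1 / 2) (by norm_num) (h _ (by norm_num))

/-- The same for the round-1 stub 2 (normalised by `|F_{x_c,5/8}(b_δ)|`). -/
theorem localL1Bound_false_without_exhaustion {s : ℝ} (hs : s ≤ 1) :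
    ¬ LocalL1BoundWithoutExhaustion s := by
  intro h
  obtain ⟨C, hC⟩ := h D₀ (1 / 4) Λ₃ mRow aE bE (by norm_num) D₀_flat_quarter frame_Λ₃
    tendsto_aE tendsto_bE Kbox Kbox_compact Kbox_sub
  exact Λ₃_violates C s (5 / 8) (5 / 8) hs hC

end Violation3

/-- `MassRatioWithoutExhaustion` is a strengthening of the crux (bookkeeping: it IS the crux with one
hypothesis deleted). -/
theorem massRatio_of_withoutExhaustion (h : MassRatioWithoutExhaustion) : MassRatio := by
  intro D ρ Λ m a b Z hρ hflat hadm _hexh ha hb K hK hKD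
  exact h D ρ Λ m a b hρ hflat hadm ha hb K hK hKD

/-- `LocalL1BoundZ s` — verbatim copy of the skeleton's reshaped stub-2 predicate
(`Lines/coherence-floor-rh-harnack.lean`, reshape 2; the registered stub is `∀ s > 0, LocalL1BoundZ s`). -/
def LocalL1BoundZ (s : ℝ) : Prop :=
  ∀ (D : DobrushinDomain) (ρ : ℝ) (Λ : ℝ → Finset HexVertex) (m : ℝ → ℤ)
    (a b : ℝ → Sym2 HexVertex),
    0 < ρ →
    D.carrier ∩ Metric.ball (D.pt 1) ρ = {z : ℂ | (D.pt 1).im < z.im} ∩ Metric.ball (D.pt 1) ρ →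
    (∀ᶠ δ : ℝ in nhdsWithin 0 (Set.Ioi 0),
      hexDomainSimplyConnected (Λ δ) ∧ a δ ∈ hexDomainBoundary (Λ δ) ∧
        b δ ∈ hexDomainBoundary (Λ δ) ∧ Nonempty (HexMidEdgeSAW (Λ δ) (a δ) (b δ)) ∧
        (hexGraph.induce ((Λ δ : Finset HexVertex) : Set HexVertex)).Preconnected ∧
        (∀ v ∈ Λ δ, (δ : ℂ) * hexCenter v ∈ D.carrier) ∧
        (∀ v : HexVertex, (δ : ℂ) * hexCenter v ∈ Metric.ball (D.pt 1) ρ →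
          (v ∈ Λ δ ↔ m δ ≤ v.1 1))) →
    (∀ K : Set ℂ, IsCompact K → K ⊆ D.carrier → ∀ᶠ δ : ℝ in nhdsWithin 0 (Set.Ioi 0),
      ∀ v : HexVertex, (δ : ℂ) * hexCenter v ∈ K → v ∈ Λ δ) →
    Filter.Tendsto (fun δ : ℝ => (δ : ℂ) * hexMidpoint (a δ)) (nhdsWithin 0 (Set.Ioi 0))
      (nhds (D.pt 0)) →
    Filter.Tendsto (fun δ : ℝ => (δ : ℂ) * hexMidpoint (b δ)) (nhdsWithin 0 (Set.Ioi 0))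
      (nhds (D.pt 1)) →
    ∀ K : Set ℂ, IsCompact K → K ⊆ D.carrier → ∃ C : ℝ,
      ∀ᶠ δ : ℝ in nhdsWithin 0 (Set.Ioi 0),
        δ ^ 2 * (∑ᶠ e ∈ {e : Sym2 HexVertex | e ∈ hexDomainMidEdges (Λ δ) ∧
            (δ : ℂ) * hexMidpoint e ∈ K},
            ‖hexParafermionicObservable (Λ δ) (a δ) hexCriticalFugacity (5 / 8) e‖) ≤
          C * δ ^ (-s) * ‖hexParafermionicObservable (Λ δ) (a δ) hexCriticalFugacity 0 (b δ)‖

/-- `LocalL1BoundZWithoutExhaustion s` is `LocalL1BoundZ s` with one hypothesis deleted (bookkeeping). -/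
theorem localL1BoundZ_of_withoutExhaustion {s : ℝ} (h : LocalL1BoundZWithoutExhaustion s) :
    LocalL1BoundZ s := by
  intro D ρ Λ m a b hρ hflat hadm _hexh ha hb K hK hKD
  exact h D ρ Λ m a b hρ hflat hadm ha hb K hK hKD

end Summit.CriticalPhenomena.SAWScalingLimit.Cruxes.MassRatio.Disproof
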